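import Summits.PneNP.PneNP.Theorems.ConstantBand.Negative.LoadBearing
import Summits.PneNP.PneNP.Theorems.SingleThreshold.Negative.LoadBearing
import Summits.PneNP.PneNP.Theorems.SliceACZero.Negative.WindowDepth
import Literature.Computability.Complexity.CliqueThresholdBounds
import Summits.PneNP.PneNP.Theorems.OneSliceConstantBandTransferStepAux

set_option linter.dupNamespace false

namespace Summit.PneNP.PneNP.Cruxes.SliceTarget.Ideator3Line
section A1
open Literature.Computability.Complexity Finset Filter Classical
open scoped Topology
open Summit.PneNP.PneNP.Theorems.ConstantBand.Negative (Edge thr Central slice)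
open Summit.PneNP.PneNP.Theorems.SliceACZero.Negative (sliceCard sliceCard_eq card_slice_supset_le
  choose_sub_mul_pow_le_choose_mul_pow)

noncomputable section

/-! ## Ratios of binomial coefficients -/

/-- **Neighbouring binomial coefficients**: `C(M, t-s)·(M+1-t)^s ≤ C(M, t)·t^s` for `s ≤ t ≤ M`
(iterate `C(M, a+1)·(a+1) = C(M, a)·(M-a)` with `a + 1 ≤ t`, `M - a ≥ M + 1 - t`). [folklore] -/
theorem pb_choose_sub_mul_pow_le {M t : ℕ} (htM : t ≤ M) (s : ℕ) (hs : s ≤ t) :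
    M.choose (t - s) * (M + 1 - t) ^ s ≤ M.choose t * t ^ s := by
  induction s with
  | zero => simp
  | succ s ih =>
    have key : M.choose (t - (s + 1)) * (M + 1 - t) ≤ M.choose (t - s) * t := by
      have h := Nat.choose_succ_right_eq M (t - (s + 1))
      have h1 : t - (s + 1) + 1 = t - s := by omega
      rw [h1] at h
      calc M.choose (t - (s + 1)) * (M + 1 - t) ≤ M.choose (t - (s + 1)) * (M - (t - (s + 1))) :=
            Nat.mul_le_mul_left _ (by omega)
        _ = M.choose (t - s) * (t - s) := h.symm
        _ ≤ M.choose (t - s) * t := Nat.mul_le_mul_left _ (Nat.sub_le _ _)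
    calc M.choose (t - (s + 1)) * (M + 1 - t) ^ (s + 1)
        = M.choose (t - (s + 1)) * (M + 1 - t) * (M + 1 - t) ^ s := by ring
      _ ≤ M.choose (t - s) * t * (M + 1 - t) ^ s := Nat.mul_le_mul_right _ key
      _ = t * (M.choose (t - s) * (M + 1 - t) ^ s) := by ring
      _ ≤ t * (M.choose t * t ^ s) := Nat.mul_le_mul_left _ (ih (by omega))
      _ = M.choose t * t ^ (s + 1) := by ring

/-- The `t`-subsets `T ⊆ U` meeting a fixed `D` in exactly `s` elements number at most `2^{#D}·C(#U, t-s)`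
(`T ↦ (D ∩ T, T ∖ D)` is injective). [folklore] -/
theorem pb_card_filter_card_inter_le {α : Type*} [DecidableEq α] (U D : Finset α) (t s : ℕ) :
    #((powersetCard t U).filter fun T => #(D ∩ T) = s) ≤ 2 ^ #D * (#U).choose (t - s) := by
  calc #((powersetCard t U).filter fun T => #(D ∩ T) = s) ≤ #(D.powerset ×ˢ powersetCard (t - s) U) := by
        refine card_le_card_of_injOn (fun T => (D ∩ T, T \ D)) (fun T hT => ?_) (fun T₁ _ T₂ _ h => ?_)
        · rw [mem_coe, mem_filter, mem_powersetCard] at hT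
          obtain ⟨⟨hTU, hTt⟩, hs⟩ := hT
          simp only [mem_coe, mem_product, mem_powerset, mem_powersetCard]
          refine ⟨inter_subset_left, sdiff_subset.trans hTU, ?_⟩
          have := card_sdiff_add_card_inter T D
          rw [inter_comm] at hs
          omega
        · simp only [Prod.mk.injEq] at h
          ext v
          by_cases hv : v ∈ D
          · simpa [hv] using congrArg (v ∈ ·) h.1
          · simpa [hv] using congrArg (v ∈ ·) h.2
    _ = 2 ^ #D * (#U).choose (t - s) := by rw [card_product, card_powerset, card_powersetCard]

/-- **Union exponents over a uniform layer.** For a fixed set `D`, `0 < q ≤ 1`, `t ≤ M = #U` and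
`t ≤ (M+1-t)·q`: `Σ_{T ⊆ U, #T = t} q^{#(D ∪ T)} ≤ C(M,t)·q^{#D+t}·(1 + 2^{#D}·t·(t/((M+1-t)·q)))` — the `T`
disjoint from `D` contribute `q^{#D+t}` each, those with `#(D ∩ T) = s ≥ 1` are `≤ 2^{#D} C(M,t-s) ≤ 2^{#D} C(M,t)(t/(M+1-t))^s`
in number and contribute `q^{#D+t-s}` each. [folklore] -/
theorem pb_sum_pow_card_union_le {α : Type*} [DecidableEq α] (U D : Finset α) {t : ℕ} (ht : t ≤ #U)
    {q : ℝ} (hq0 : 0 < q) (hy : (t : ℝ) ≤ ((#U : ℝ) + 1 - t) * q) :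
    ∑ T ∈ powersetCard t U, q ^ #(D ∪ T) ≤
      ((#U).choose t : ℝ) * q ^ (#D + t) * (1 + 2 ^ #D * t * ((t : ℝ) / (((#U : ℝ) + 1 - t) * q))) := by
  set M := #U with hM
  set y : ℝ := (t : ℝ) / (((M : ℝ) + 1 - t) * q) with hy_def
  have hMt : (0 : ℝ) < (M : ℝ) + 1 - t := by
    have : (t : ℝ) ≤ M := by exact_mod_cast ht
    linarith
  have hden : (0 : ℝ) < ((M : ℝ) + 1 - t) * q := mul_pos hMt hq0
  have hy0 : 0 ≤ y := div_nonneg (Nat.cast_nonneg _) hden.le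
  have hy1 : y ≤ 1 := (div_le_one hden).2 hy
  -- group the `T` by `s = #(D ∩ T)`
  have hmaps : ∀ T ∈ powersetCard t U, #(D ∩ T) ∈ range (t + 1) := by
    intro T hT
    rw [mem_range, Nat.lt_succ_iff, ← (mem_powersetCard.1 hT).2]
    exact card_le_card inter_subset_right
  rw [← sum_fiberwise_of_maps_to hmaps]
  have hfib : ∀ s ∈ range (t + 1),
      ∑ T ∈ (powersetCard t U).filter (fun T => #(D ∩ T) = s), q ^ #(D ∪ T) =
        #((powersetCard t U).filter fun T => #(D ∩ T) = s) * q ^ (#D + t - s) := by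
    intro s _
    rw [← nsmul_eq_mul, ← sum_const]
    refine sum_congr rfl fun T hT => ?_
    obtain ⟨hT, hs⟩ := mem_filter.1 hT
    have h := card_union_add_card_inter D T
    rw [(mem_powersetCard.1 hT).2, hs] at h
    rw [show #(D ∪ T) = #D + t - s by omega]
  rw [sum_congr rfl hfib, sum_range_succ']
  -- the `T` disjoint from `D`
  have h0 : (#((powersetCard t U).filter fun T => #(D ∩ T) = 0) : ℝ) * q ^ (#D + t - 0) ≤
      (M.choose t : ℝ) * q ^ (#D + t) := by
    rw [Nat.sub_zero]
    refine mul_le_mul_of_nonneg_right ?_ (pow_nonneg hq0.le _)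
    have h := card_le_card (filter_subset (fun T => #(D ∩ T) = 0) (powersetCard t U))
    rw [card_powersetCard] at h
    exact_mod_cast h
  -- the `T` meeting `D` in `s + 1` elements
  have h1 : ∀ s ∈ range t, (#((powersetCard t U).filter fun T => #(D ∩ T) = s + 1) : ℝ) * q ^ (#D + t - (s + 1)) ≤
      (M.choose t : ℝ) * q ^ (#D + t) * (2 ^ #D * y) := by
    intro s hs
    rw [mem_range] at hs
    have hcount : (#((powersetCard t U).filter fun T => #(D ∩ T) = s + 1) : ℝ) ≤ 2 ^ #D * (M.choose (t - (s + 1)) : ℝ) := by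
      exact_mod_cast pb_card_filter_card_inter_le U D t (s + 1)
    have hratio : (M.choose (t - (s + 1)) : ℝ) * ((M : ℝ) + 1 - t) ^ (s + 1) ≤ (M.choose t : ℝ) * (t : ℝ) ^ (s + 1) := by
      have h := pb_choose_sub_mul_pow_le ht (s + 1) (by omega)
      have hc : (((M + 1 - t : ℕ) : ℝ)) = (M : ℝ) + 1 - t := by
        rw [Nat.cast_sub (by omega), Nat.cast_add, Nat.cast_one]
      rw [← hc]
      exact_mod_cast h
    have hqpow : q ^ (#D + t - (s + 1)) = q ^ (#D + t) / q ^ (s + 1) := by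
      rw [eq_div_iff (pow_pos hq0 _).ne', ← pow_add, Nat.sub_add_cancel (by omega)]
    have hys : y ^ (s + 1) ≤ y := pow_le_of_le_one hy0 hy1 (Nat.succ_ne_zero s)
    have hpow0 : (0 : ℝ) < ((M : ℝ) + 1 - t) ^ (s + 1) := pow_pos hMt _
    calc (#((powersetCard t U).filter fun T => #(D ∩ T) = s + 1) : ℝ) * q ^ (#D + t - (s + 1))
        ≤ 2 ^ #D * (M.choose (t - (s + 1)) : ℝ) * (q ^ (#D + t) / q ^ (s + 1)) := by
          rw [hqpow]; exact mul_le_mul_of_nonneg_right hcount (by positivity)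
      _ ≤ 2 ^ #D * ((M.choose t : ℝ) * (t : ℝ) ^ (s + 1) / ((M : ℝ) + 1 - t) ^ (s + 1)) * (q ^ (#D + t) / q ^ (s + 1)) := by
          gcongr
          rw [le_div_iff₀ hpow0]
          exact hratio
      _ = (M.choose t : ℝ) * q ^ (#D + t) * (2 ^ #D * y ^ (s + 1)) := by
          rw [hy_def, div_pow, mul_pow]
          field_simp
      _ ≤ (M.choose t : ℝ) * q ^ (#D + t) * (2 ^ #D * y) := by gcongr
  calc ∑ s ∈ range t, (#((powersetCard t U).filter fun T => #(D ∩ T) = s + 1) : ℝ) * q ^ (#D + t - (s + 1)) +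
        (#((powersetCard t U).filter fun T => #(D ∩ T) = 0) : ℝ) * q ^ (#D + t - 0)
      ≤ ∑ _s ∈ range t, (M.choose t : ℝ) * q ^ (#D + t) * (2 ^ #D * y) + (M.choose t : ℝ) * q ^ (#D + t) :=
        add_le_add (sum_le_sum h1) h0
    _ = (M.choose t : ℝ) * q ^ (#D + t) * (1 + 2 ^ #D * t * y) := by
        rw [sum_const, card_range, nsmul_eq_mul]; ring

/-! ## Slice counts -/

/-- **Hypergeometric tail on a slice**: for `j ≤ N = C(n,2)`, `0 < N` and a fixed edge set `E`,
`#{x ∈ slice_j : E ⊆ x} ≤ (j/N)^{#E}·#slice_j`. [folklore] -/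
theorem pb_card_slice_supset_le {n j : ℕ} (E : Finset (Edge n)) (hjN : j ≤ n.choose 2) (hN : 0 < n.choose 2) :
    (#((slice n j).filter fun x => ∀ e ∈ E, x e = true) : ℝ) ≤ ((j : ℝ) / (n.choose 2 : ℕ)) ^ #E * #(slice n j) := by
  -- adapted from Theorems/OneSliceSliceTargetCoincidenceTail2.lean (`card_slice_filter_supset_mul_le`)
  have hslice : #(slice n j) = (n.choose 2).choose j := sliceCard_eq n j
  have hNr : (0 : ℝ) < (n.choose 2 : ℕ) := by exact_mod_cast hN
  rw [div_pow, div_mul_eq_mul_div, le_div_iff₀ (pow_pos hNr _)]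
  by_cases hE : #E ≤ j
  · have h1 : #((slice n j).filter fun x => ∀ e ∈ E, x e = true) ≤ (n.choose 2 - #E).choose (j - #E) := by
      have h := card_slice_supset_le j E hE
      rwa [← filter_filter] at h
    have h2 := choose_sub_mul_pow_le_choose_mul_pow hE hjN
    calc (#((slice n j).filter fun x => ∀ e ∈ E, x e = true) : ℝ) * ((n.choose 2 : ℕ) : ℝ) ^ #E
        ≤ (((n.choose 2 - #E).choose (j - #E) : ℕ) : ℝ) * ((n.choose 2 : ℕ) : ℝ) ^ #E := by
          exact mul_le_mul_of_nonneg_right (by exact_mod_cast h1) (by positivity)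
      _ ≤ (((n.choose 2).choose j : ℕ) : ℝ) * (j : ℝ) ^ #E := by exact_mod_cast h2
      _ = (j : ℝ) ^ #E * #(slice n j) := by rw [hslice, mul_comm]
  · have h0 : (slice n j).filter (fun x => ∀ e ∈ E, x e = true) = ∅ := by
      refine filter_eq_empty_iff.2 fun x hx hall => hE ?_
      rw [← (mem_filter.1 hx).2, edgeCount]
      exact card_le_card fun e he => mem_filter.2 ⟨mem_univ _, hall e he⟩
    rw [h0, card_empty, Nat.cast_zero, zero_mul]
    positivity

/-- **The double count behind the replica term.** For `D` with `#D ≤ 2K`, `t ≤ K`, `4K ≤ j ≤ N = C(n,2)`, `4K ≤ N`,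
`1 ≤ K` and a read set `F` with `2·#F ≤ N` (`U = Fᶜ`, `M = #U`):
`Σ_{x ∈ slice_j, D ⊆ x} C(#(x ∖ F), t)/C(M, t) ≤ (1 + 4^{K+1}K²/j)·(j/N)^{#D+t}·#slice_j`. Indeed `C(#(x ∖ F), t)`
counts the `t`-sets `T ⊆ U` inside `x`, so the left side is `Σ_{T ⊆ U, #T=t} #{x ∈ slice_j : D ∪ T ⊆ x}/C(M,t)
≤ Σ_T q^{#(D ∪ T)}·#slice_j/C(M,t)` (`pb_card_slice_supset_le`), and `pb_sum_pow_card_union_le` applies with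
`(M+1-t)q ≥ j/4 ≥ K`. [folklore] -/
theorem pb_sum_choose_div_le {n j K t : ℕ} (F D : Finset (Edge n)) (htK : t ≤ K) (hD : #D ≤ 2 * K) (hK : 1 ≤ K)
    (hKN : 4 * K ≤ n.choose 2) (hKj : 4 * K ≤ j) (hjN : j ≤ n.choose 2) (h2F : 2 * #F ≤ n.choose 2) :
    ∑ x ∈ (slice n j).filter (fun x => ∀ e ∈ D, x e = true),
        (((#(onSet x \ F)).choose t : ℕ) : ℝ) / ((#Fᶜ).choose t : ℕ) ≤
      (1 + 4 ^ (K + 1) * (K : ℝ) ^ 2 / j) * ((j : ℝ) / (n.choose 2 : ℕ)) ^ (#D + t) * #(slice n j) := by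
  set N := n.choose 2 with hNdef
  set M := #Fᶜ with hM
  set q : ℝ := (j : ℝ) / (N : ℕ) with hq
  set X := (slice n j).filter (fun x => ∀ e ∈ D, x e = true) with hX
  have hMval : M = N - #F := by rw [hM, card_compl, card_edgeSet_top_fin]
  have hN : 0 < N := by omega
  have hNr : (0 : ℝ) < (N : ℕ) := by exact_mod_cast hN
  have hj0 : (0 : ℝ) < j := by exact_mod_cast (show 0 < j by omega)
  have hq0 : 0 < q := div_pos hj0 hNr
  have htM : t ≤ M := by omega
  have hS0 : (0 : ℝ) ≤ #(slice n j) := Nat.cast_nonneg _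
  -- Step 1: `C(#(x ∖ F), t) = #{T ⊆ U : #T = t, T ⊆ x}` and the swap of sums
  have key : ∀ x ∈ X, (#(onSet x \ F)).choose t = #((powersetCard t Fᶜ).filter fun T => ∀ e ∈ T, x e = true) := by
    intro x _
    rw [← card_powersetCard]
    congr 1
    ext T
    rw [mem_powersetCard, mem_filter, mem_powersetCard]
    constructor
    · rintro ⟨h1, h2⟩
      exact ⟨⟨fun e he => mem_compl.2 (mem_sdiff.1 (h1 he)).2, h2⟩,
        fun e he => (mem_onSet x e).1 (mem_sdiff.1 (h1 he)).1⟩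
    · rintro ⟨⟨h1, h2⟩, h3⟩
      exact ⟨fun e he => mem_sdiff.2 ⟨(mem_onSet x e).2 (h3 e he), mem_compl.1 (h1 he)⟩, h2⟩
  have hswap := sum_card_bipartiteAbove_eq_sum_card_bipartiteBelow
    (fun (x : Edge n → Bool) (T : Finset (Edge n)) => ∀ e ∈ T, x e = true) (s := X) (t := powersetCard t Fᶜ)
  simp only [bipartiteAbove, bipartiteBelow] at hswap
  have hdc : ∑ x ∈ X, (((#(onSet x \ F)).choose t : ℕ) : ℝ) =
      ∑ T ∈ powersetCard t Fᶜ, (#(X.filter fun x => ∀ e ∈ T, x e = true) : ℝ) := by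
    have h : ∑ x ∈ X, (#(onSet x \ F)).choose t = ∑ T ∈ powersetCard t Fᶜ, #(X.filter fun x => ∀ e ∈ T, x e = true) := by
      rw [sum_congr rfl key]; exact hswap
    exact_mod_cast congrArg (Nat.cast (R := ℝ)) h
  -- Step 2: each inner count is a slice count
  have hT : ∀ T ∈ powersetCard t Fᶜ, (#(X.filter fun x => ∀ e ∈ T, x e = true) : ℝ) ≤ q ^ #(D ∪ T) * #(slice n j) := by
    intro T _
    have heq : X.filter (fun x => ∀ e ∈ T, x e = true) = (slice n j).filter (fun x => ∀ e ∈ D ∪ T, x e = true) := by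
      rw [hX, filter_filter]
      refine filter_congr fun x _ => ?_
      simp only [mem_union]
      exact ⟨fun h e he => he.elim (h.1 e) (h.2 e), fun h => ⟨fun e he => h e (Or.inl he), fun e he => h e (Or.inr he)⟩⟩
    rw [heq]
    exact pb_card_slice_supset_le (D ∪ T) hjN hN
  -- Step 3: the layer sum
  have hMhalf : (N : ℝ) ≤ 4 * ((M : ℝ) + 1 - t) := by
    have h : N ≤ 4 * (M + 1 - t) := by omega
    have h' : ((4 * (M + 1 - t) : ℕ) : ℝ) = 4 * ((M : ℝ) + 1 - t) := by
      rw [Nat.cast_mul, Nat.cast_sub (by omega)]; push_cast; ring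
    rw [← h']; exact_mod_cast h
  have hden : (j : ℝ) / 4 ≤ ((M : ℝ) + 1 - t) * q := by
    calc (j : ℝ) / 4 = ((N : ℕ) : ℝ) / 4 * ((j : ℝ) / (N : ℕ)) := by field_simp
      _ ≤ ((M : ℝ) + 1 - t) * q := by
          rw [hq]
          exact mul_le_mul_of_nonneg_right (by linarith) (div_nonneg hj0.le hNr.le)
  have hKr : (1 : ℝ) ≤ K := by exact_mod_cast hK
  have htr : (t : ℝ) ≤ K := by exact_mod_cast htK
  have hjK : 4 * (K : ℝ) ≤ j := by exact_mod_cast hKj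
  have hy : (t : ℝ) ≤ ((M : ℝ) + 1 - t) * q := by linarith
  have hlayer := pb_sum_pow_card_union_le Fᶜ D htM hq0 hy
  have hθ : 2 ^ #D * t * ((t : ℝ) / (((M : ℝ) + 1 - t) * q)) ≤ 4 ^ (K + 1) * (K : ℝ) ^ 2 / j := by
    have hd0 : (0 : ℝ) < ((M : ℝ) + 1 - t) * q := by linarith
    have h1 : (t : ℝ) / (((M : ℝ) + 1 - t) * q) ≤ 4 * K / j := by
      rw [div_le_div_iff₀ hd0 hj0]; nlinarith
    have h2 : (2 : ℝ) ^ #D ≤ 4 ^ K := by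
      calc (2 : ℝ) ^ #D ≤ 2 ^ (2 * K) := pow_le_pow_right₀ (by norm_num) hD
        _ = 4 ^ K := by rw [pow_mul]; norm_num
    calc 2 ^ #D * t * ((t : ℝ) / (((M : ℝ) + 1 - t) * q)) ≤ 4 ^ K * K * (4 * K / j) := by
          gcongr
      _ = 4 ^ (K + 1) * (K : ℝ) ^ 2 / j := by rw [pow_succ]; ring
  have hMc : (0 : ℝ) < (M.choose t : ℕ) := by exact_mod_cast Nat.choose_pos htM
  -- assemble
  rw [← sum_div, hdc, div_le_iff₀ hMc]
  calc ∑ T ∈ powersetCard t Fᶜ, (#(X.filter fun x => ∀ e ∈ T, x e = true) : ℝ)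
      ≤ ∑ T ∈ powersetCard t Fᶜ, q ^ #(D ∪ T) * #(slice n j) := sum_le_sum hT
    _ = (∑ T ∈ powersetCard t Fᶜ, q ^ #(D ∪ T)) * #(slice n j) := by rw [sum_mul]
    _ ≤ ((M.choose t : ℝ) * q ^ (#D + t) * (1 + 2 ^ #D * t * ((t : ℝ) / (((M : ℝ) + 1 - t) * q)))) * #(slice n j) :=
        mul_le_mul_of_nonneg_right hlayer hS0
    _ ≤ ((M.choose t : ℝ) * q ^ (#D + t) * (1 + 4 ^ (K + 1) * (K : ℝ) ^ 2 / j)) * #(slice n j) := by gcongr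
    _ = (1 + 4 ^ (K + 1) * (K : ℝ) ^ 2 / j) * q ^ (#D + t) * #(slice n j) * (M.choose t : ℕ) := by ring

/-- **The double count behind the replica term, registered form** (helper of stub B3 `stub_pairBound`; closed statement
`pb_sum_choose_div_le`): `Σ_{x ∈ slice_j, D ⊆ x} C(#(x ∖ F), t)/C(#Fᶜ, t) ≤ (1 + 4^{K+1}K²/j)·(j/N)^{#D+t}·#slice_j` for
`t ≤ K`, `#D ≤ 2K`, `1 ≤ K`, `4K ≤ N`, `4K ≤ j ≤ N`, `2·#F ≤ N`. [folklore] -/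
theorem pb_pairTermCount :
    ∀ (n j K t : ℕ) (F D : Finset (Edge n)), t ≤ K → #D ≤ 2 * K → 1 ≤ K → 4 * K ≤ n.choose 2 → 4 * K ≤ j →
      j ≤ n.choose 2 → 2 * #F ≤ n.choose 2 →
        ∑ x ∈ (slice n j).filter (fun x => ∀ e ∈ D, x e = true),
            (((#(onSet x \ F)).choose t : ℕ) : ℝ) / ((#Fᶜ).choose t : ℕ) ≤
          (1 + 4 ^ (K + 1) * (K : ℝ) ^ 2 / j) * ((j : ℝ) / (n.choose 2 : ℕ)) ^ (#D + t) * #(slice n j) :=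
  fun _ _ _ _ F D htK hD hK hKN hKj hjN h2F => pb_sum_choose_div_le F D htK hD hK hKN hKj hjN h2F

/-! ## Few `k`-sets have all their clique edges read -/

/-- **Few `k`-sets have all their clique edges in `F`**: for `2 ≤ k` and `#F ≤ N = C(n,2)`,
`N · #{A : K_A ⊆ F} ≤ #F · C(n,k)`. Double counting: `Σ_A #(K_A ∖ F) = Σ_{e ∉ F} #{A ∋ both ends of e} = (N - #F)·C(n-2,k-2)`,
each `#(K_A ∖ F) ≤ C(k,2)` and vanishes when `K_A ⊆ F`, and `N·C(n-2,k-2) = C(k,2)·C(n,k)`. [folklore] -/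
theorem pb_card_filter_cliqueEdges_subset_mul_le {n k : ℕ} (hk : 2 ≤ k) (F : Finset (Edge n)) (hF : #F ≤ n.choose 2) :
    n.choose 2 * #((powersetCard k (univ : Finset (Fin n))).filter fun A =>
        #((univ.filter fun e : Edge n => cliqueVec A e = true) \ F) = 0) ≤ #F * n.choose k := by
  set 𝒜 := powersetCard k (univ : Finset (Fin n)) with h𝒜
  set S : Finset (Fin n) → Finset (Edge n) := fun A => univ.filter fun e : Edge n => cliqueVec A e = true with hS
  set N := n.choose 2 with hN
  set K := k.choose 2 with hK
  have hcard𝒜 : #𝒜 = n.choose k := by rw [h𝒜, card_powersetCard, card_univ, Fintype.card_fin]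
  have hSA : ∀ A ∈ 𝒜, #(S A) = K := fun A hA => by rw [hS, hK]; simp only; rw [card_filter_cliqueVec, (mem_powersetCard.1 hA).2]
  -- double counting `Σ_A #(S A ∖ F) = Σ_{e ∈ Fᶜ} #{A : e ∈ S A} = #Fᶜ · C(n-2, k-2)`
  have hswap := sum_card_bipartiteAbove_eq_sum_card_bipartiteBelow
    (fun (A : Finset (Fin n)) (e : Edge n) => cliqueVec A e = true) (s := 𝒜) (t := Fᶜ)
  simp only [bipartiteAbove, bipartiteBelow] at hswap
  have hleft : ∀ A ∈ 𝒜, #(Fᶜ.filter fun e => cliqueVec A e = true) = #(S A \ F) := by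
    intro A _
    congr 1; ext e; simp [hS, and_comm]
  have hright : ∀ e ∈ Fᶜ, #(𝒜.filter fun A => cliqueVec A e = true) = (n - 2).choose (k - 2) := by
    intro e _
    have h := card_filter_powersetCard_subset (endpts e) (univ : Finset (Fin n)) k (subset_univ _)
      (by rw [card_endpts]; exact hk)
    rw [card_univ, Fintype.card_fin, card_endpts] at h
    rw [← h, h𝒜]
    congr 1
    exact filter_congr fun A _ => cliqueVec_eq_true_iff_endpts A e
  have hsum : ∑ A ∈ 𝒜, #(S A \ F) = #Fᶜ * (n - 2).choose (k - 2) := by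
    rw [← sum_congr rfl hleft, hswap, sum_congr rfl hright, sum_const, smul_eq_mul]
  -- `Σ_A #(S A ∖ F) ≤ K · #{A : #(S A ∖ F) ≠ 0}`
  have hup : ∑ A ∈ 𝒜, #(S A \ F) ≤ K * #(𝒜.filter fun A => ¬ #(S A \ F) = 0) := by
    rw [← sum_filter_add_sum_filter_not 𝒜 (fun A => #(S A \ F) = 0), sum_congr rfl fun A hA => (mem_filter.1 hA).2,
      sum_const_zero, zero_add, mul_comm]
    calc ∑ A ∈ 𝒜.filter (fun A => ¬ #(S A \ F) = 0), #(S A \ F) ≤ ∑ _A ∈ 𝒜.filter (fun A => ¬ #(S A \ F) = 0), K :=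
          sum_le_sum fun A hA => (card_le_card sdiff_subset).trans (hSA A (mem_filter.1 hA).1).le
      _ = #(𝒜.filter fun A => ¬ #(S A \ F) = 0) * K := by rw [sum_const, smul_eq_mul]
  have hNK : n.choose k * K = N * (n - 2).choose (k - 2) := Nat.choose_mul hk
  have hsplit := card_filter_add_card_filter_not (s := 𝒜) (fun A => #(S A \ F) = 0)
  have hM : #Fᶜ = N - #F := by rw [card_compl, card_edgeSet_top_fin]
  have hKpos : 0 < K := Nat.choose_pos hk
  -- `N · K · #{≠ 0} ≥ N · Σ = N · M · C(n-2,k-2) = M · K · C(n,k)`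
  have h1 : (N - #F) * (n.choose k * K) ≤ N * (K * #(𝒜.filter fun A => ¬ #(S A \ F) = 0)) := by
    rw [hNK, show (N - #F) * (N * (n - 2).choose (k - 2)) = N * (#Fᶜ * (n - 2).choose (k - 2)) by rw [hM]; ring, ← hsum]
    exact Nat.mul_le_mul_left _ hup
  have h2 : (N - #F) * n.choose k ≤ N * #(𝒜.filter fun A => ¬ #(S A \ F) = 0) := by
    have : (N - #F) * n.choose k * K ≤ N * #(𝒜.filter fun A => ¬ #(S A \ F) = 0) * K := by
      calc (N - #F) * n.choose k * K = (N - #F) * (n.choose k * K) := by ring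
        _ ≤ N * (K * #(𝒜.filter fun A => ¬ #(S A \ F) = 0)) := h1
        _ = N * #(𝒜.filter fun A => ¬ #(S A \ F) = 0) * K := by ring
    exact Nat.le_of_mul_le_mul_right this hKpos
  rw [hcard𝒜] at hsplit
  have h3 : N * #(𝒜.filter fun A => #(S A \ F) = 0) + N * #(𝒜.filter fun A => ¬ #(S A \ F) = 0) =
      (#F + (N - #F)) * n.choose k := by rw [← mul_add, hsplit, Nat.add_sub_cancel' hF]
  nlinarith [h2, h3]

/-! ## Clique edge sets: unions and overlaps -/

/-- `#(K_A ∪ K_B) + C(#(A ∩ B),2) = C(#A,2) + C(#B,2)` (`K_A ∩ K_B = K_{A ∩ B}`). [folklore] -/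
theorem pb_card_cliqueEdges_union_add {n : ℕ} (A B : Finset (Fin n)) :
    #((univ.filter fun e : Edge n => cliqueVec A e = true) ∪ (univ.filter fun e : Edge n => cliqueVec B e = true)) +
        (#(A ∩ B)).choose 2 = (#A).choose 2 + (#B).choose 2 := by
  -- adapted from Theorems/OneSliceSliceTargetCoincidenceTail2.lean (`card_cliqueEdges_union_add`)
  have hinter : (univ.filter fun e : Edge n => cliqueVec A e = true) ∩ (univ.filter fun e : Edge n => cliqueVec B e = true) =
      univ.filter fun e : Edge n => cliqueVec (A ∩ B) e = true := by
    rw [← filter_and]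
    refine filter_congr fun e _ => ?_
    rw [cliqueVec_inter, Bool.and_eq_true]
    tauto
  rw [← card_filter_cliqueVec A, ← card_filter_cliqueVec B, ← card_filter_cliqueVec (A ∩ B), ← hinter]
  exact card_union_add_card_inter _ _

/-- Two distinct `k`-sets meet in fewer than `k` vertices. [folklore] -/
theorem pb_card_inter_lt_of_ne {n k : ℕ} {A B : Finset (Fin n)} (hA : A ∈ powersetCard k (univ : Finset (Fin n)))
    (hB : B ∈ powersetCard k (univ : Finset (Fin n))) (hne : A ≠ B) : #(A ∩ B) < k := by
  -- adapted from Theorems/OneSliceSliceTargetCoincidenceTail2.lean (`card_inter_lt_of_ne`)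
  have hAk := (mem_powersetCard.1 hA).2
  have hBk := (mem_powersetCard.1 hB).2
  by_contra hlt
  have h1 : A ∩ B = A := eq_of_subset_of_card_le inter_subset_left (by omega)
  exact hne (eq_of_subset_of_card_le (h1 ▸ inter_subset_right) (by omega))

/-- The `k`-sets meeting a fixed `k`-set `A` in exactly `i` vertices number at most `C(k,i)·C(n,k-i)`
(`B ↦ (A ∩ B, B ∖ A)` is injective). [folklore] -/
theorem pb_card_filter_card_inter_eq_le {n k : ℕ} {A : Finset (Fin n)} (hA : #A = k) (i : ℕ) :
    #((powersetCard k (univ : Finset (Fin n))).filter fun B => #(A ∩ B) = i) ≤ k.choose i * n.choose (k - i) := by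
  -- adapted from Theorems/OneSliceSliceTargetCoincidenceTail2.lean (`card_filter_card_inter_eq_le`)
  calc #((powersetCard k (univ : Finset (Fin n))).filter fun B => #(A ∩ B) = i)
      ≤ #((powersetCard i A) ×ˢ (powersetCard (k - i) (univ : Finset (Fin n)))) := by
        refine card_le_card_of_injOn (fun B => (A ∩ B, B \ A)) (fun B hB => ?_) (fun B₁ _ B₂ _ h => ?_)
        · have hB' := hB
          simp only [mem_coe, mem_filter] at hB'
          obtain ⟨hB𝒜, hi⟩ := hB'
          have hBk : #B = k := (mem_powersetCard.1 hB𝒜).2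
          simp only [mem_coe, mem_product, mem_powersetCard]
          refine ⟨⟨inter_subset_left, hi⟩, subset_univ _, ?_⟩
          have := card_sdiff_add_card_inter B A
          rw [inter_comm] at hi
          omega
        · simp only [Prod.mk.injEq] at h
          ext v
          by_cases hv : v ∈ A
          · simpa [hv] using congrArg (v ∈ ·) h.1
          · simpa [hv] using congrArg (v ∈ ·) h.2
    _ = k.choose i * n.choose (k - i) := by
        rw [card_product, card_powersetCard, card_powersetCard, hA, card_univ, Fintype.card_fin]

end
end A1
section A2
open Literature.Computability.Complexity Finset Filter Classical
open scoped Topology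
open Summit.PneNP.PneNP.Theorems.ConstantBand.Negative (Edge thr Central slice)

noncomputable section

variable {n : ℕ}

/-! ## Fibres of a slice over a read set (re-derived from `OneSliceSliceTargetFibreCliqueUpper.lean`) -/

/-- Membership in a slice: `x ∈ slice n j ↔ e(x) = j`. [folklore] -/
private theorem pb_mem_slice_iff {j : ℕ} {x : Edge n → Bool} : x ∈ slice n j ↔ edgeCount x = j := by
  simp [Theorems.ConstantBand.Negative.slice]

/-- On a fibre over `F` the on-set meets `F` in the on-set of the pattern. [folklore] -/
private theorem pb_onSet_inter_eq {F : Finset (Edge n)} {ρ x : Edge n → Bool} (hx : ∀ e ∈ F, x e = ρ e) :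
    onSet x ∩ F = F.filter fun e => ρ e = true := by
  -- adapted from Theorems/OneSliceSliceTargetFibreCliqueUpper.lean (`onSet_inter_eq`)
  ext e
  simp only [mem_inter, mem_onSet, mem_filter]
  exact ⟨fun h => ⟨h.2, (hx e h.2).symm.trans h.1⟩, fun h => ⟨(hx e h.1).trans h.2, h.1⟩⟩

/-- On the fibre of `ρ` in the slice `j`, on-set-minus-`F` is a `(j - r)`-subset of `Fᶜ`, and `r ≤ j`
(`r = #{e ∈ F : ρ e = 1}`). [folklore] -/
private theorem pb_onSet_sdiff_mem {j : ℕ} {F : Finset (Edge n)} {ρ x : Edge n → Bool}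
    (hx : x ∈ (slice n j).filter fun x => ∀ e ∈ F, x e = ρ e) :
    onSet x \ F ∈ powersetCard (j - #(F.filter fun e => ρ e = true)) Fᶜ ∧
      #(F.filter fun e => ρ e = true) ≤ j := by
  -- adapted from Theorems/OneSliceSliceTargetFibreCliqueUpper.lean (`onSet_sdiff_mem`)
  rw [mem_filter, pb_mem_slice_iff] at hx
  have hcard := card_sdiff_add_card_inter (onSet x) F
  rw [pb_onSet_inter_eq hx.2, show #(onSet x) = edgeCount x from rfl, hx.1] at hcard
  exact ⟨mem_powersetCard.2 ⟨fun e he => mem_compl.2 (Finset.mem_sdiff.1 he).2, by omega⟩, by omega⟩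

/-- On-set-minus-`F` is injective on a fibre over `F`. [folklore] -/
private theorem pb_onSet_sdiff_injOn (j : ℕ) (F : Finset (Edge n)) (ρ : Edge n → Bool) :
    Set.InjOn (fun x : Edge n → Bool => onSet x \ F)
      ↑((slice n j).filter fun x => ∀ e ∈ F, x e = ρ e) := by
  -- adapted from Theorems/OneSliceSliceTargetFibreCliqueUpper.lean (`onSet_sdiff_injOn`)
  intro x hx y hy hxy
  have hxy' : onSet x \ F = onSet y \ F := hxy
  have hx' := (mem_filter.1 (mem_coe.1 hx)).2
  have hy' := (mem_filter.1 (mem_coe.1 hy)).2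
  funext e
  by_cases he : e ∈ F
  · exact (hx' e he).trans (hy' e he).symm
  · have h : e ∈ onSet x \ F ↔ e ∈ onSet y \ F := by rw [hxy']
    simp only [Finset.mem_sdiff, mem_onSet, he, not_false_eq_true, and_true] at h
    exact Bool.eq_iff_iff.2 h

/-- **Lower count of a fibre**: `C(N - #F, j - r) ≤ #Φ(ρ)` once `r ≤ j` — the vector that is `ρ` on `F` and the
indicator of a `(j - r)`-subset `T ⊆ Fᶜ` off `F` lies in the fibre, injectively in `T`. [folklore] -/
private theorem pb_le_card_fibre {j : ℕ} (F : Finset (Edge n)) (ρ : Edge n → Bool)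
    (hr : #(F.filter fun e => ρ e = true) ≤ j) :
    (n.choose 2 - #F).choose (j - #(F.filter fun e => ρ e = true)) ≤
      #((slice n j).filter fun x => ∀ e ∈ F, x e = ρ e) := by
  -- adapted from Theorems/OneSliceSliceTargetFibreCliqueUpper.lean (`le_card_fibre`)
  set r := #(F.filter fun e => ρ e = true) with hr_def
  have hc : #(powersetCard (j - r) Fᶜ) = (n.choose 2 - #F).choose (j - r) := by
    rw [card_powersetCard, card_compl, card_edgeSet_top_fin]
  have key : ∀ T ∈ (↑(powersetCard (j - r) Fᶜ) : Set (Finset (Edge n))), ∀ e ∈ T, e ∉ F :=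
    fun T hT e he heF => (mem_compl.1 ((mem_powersetCard.1 (mem_coe.1 hT)).1 he)) heF
  rw [← hc]
  refine card_le_card_of_injOn
    (fun T : Finset (Edge n) => fun e => if e ∈ F then ρ e else decide (e ∈ T)) ?_ ?_
  · intro T hT
    beta_reduce
    have hTF := key T hT
    have hTc := (mem_powersetCard.1 (mem_coe.1 hT)).2
    rw [mem_coe, mem_filter, pb_mem_slice_iff]
    refine ⟨?_, fun e he => by simp [he]⟩
    have honT : onSet (fun e => if e ∈ F then ρ e else decide (e ∈ T)) =
        (F.filter fun e => ρ e = true) ∪ T := by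
      ext e
      rw [mem_onSet, mem_union, mem_filter]
      by_cases he : e ∈ F
      · have heT : e ∉ T := fun heT => hTF e heT he
        simp [he, heT]
      · simp [he]
    rw [← show #(onSet fun e => if e ∈ F then ρ e else decide (e ∈ T)) =
        edgeCount (fun e => if e ∈ F then ρ e else decide (e ∈ T)) from rfl, honT, card_union_of_disjoint, hTc]
    · omega
    · exact disjoint_left.2 fun e he heT => hTF e heT (mem_filter.1 he).1
  · intro T hT T' hT' hTT'
    ext e
    by_cases he : e ∈ F
    · exact ⟨fun h => absurd he (key T hT e h), fun h => absurd he (key T' hT' e h)⟩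
    · simpa [he] using congrFun hTT' e

/-- **Members of a fibre switching on a fixed `S ⊆ Fᶜ`** number at most `C(N - #F - #S, j - r - #S)` when
`#S ≤ j - r`: on-set-minus-`F` injects them into the `(j - r)`-subsets of `Fᶜ` containing `S`. [folklore] -/
private theorem pb_card_fibre_supset_le {j : ℕ} (F : Finset (Edge n)) (ρ : Edge n → Bool) (S : Finset (Edge n))
    (hSF : ∀ e ∈ S, e ∉ F) (hSj : #S ≤ j - #(F.filter fun e => ρ e = true)) :
    #(((slice n j).filter fun x => ∀ e ∈ F, x e = ρ e).filter fun x => ∀ e ∈ S, x e = true) ≤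
      (n.choose 2 - #F - #S).choose (j - #(F.filter fun e => ρ e = true) - #S) := by
  -- adapted from Theorems/OneSliceSliceTargetFibreCliqueUpper.lean (`card_fibre_supset_le`)
  set r := #(F.filter fun e => ρ e = true) with hr_def
  calc #(((slice n j).filter fun x => ∀ e ∈ F, x e = ρ e).filter fun x => ∀ e ∈ S, x e = true)
      ≤ #((powersetCard (j - r) Fᶜ).filter fun Q => S ⊆ Q) := by
        refine card_le_card_of_injOn (fun x : Edge n → Bool => onSet x \ F) ?_ ?_
        · intro x hx
          beta_reduce
          rw [mem_coe, mem_filter] at hx ⊢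
          refine ⟨(pb_onSet_sdiff_mem hx.1).1, fun e he => ?_⟩
          rw [Finset.mem_sdiff, mem_onSet]
          exact ⟨hx.2 e he, hSF e he⟩
        · exact (pb_onSet_sdiff_injOn j F ρ).mono (coe_subset.2 (filter_subset _ _))
    _ ≤ (#Fᶜ - #S).choose (j - r - #S) := card_filter_supset_powersetCard_le _ _ hSj
    _ = (n.choose 2 - #F - #S).choose (j - r - #S) := by rw [card_compl, card_edgeSet_top_fin]

/-! ## The clique count on a fibre against the fibre size -/

/-- **`c(ρ)·C(M, t) ≤ #Φ(ρ)·C(j - r, t)`**: on a nonempty fibre `Φ(ρ)` (`M = C(n,2) - #F`, `r = #(ρ⁻¹(1) ∩ F)`), the members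
switching on a fixed edge set `S` with `t = #(S ∖ F)` number at most `#Φ(ρ)·C(j-r, t)/C(M, t)`: they are
`≤ C(M - t, (j-r) - t)` (`pb_card_fibre_supset_le`), `#Φ(ρ) ≥ C(M, j-r)` (`pb_le_card_fibre`), and
`C(M-t, m-t)·C(M, t) = C(M, m)·C(m, t)` (`Nat.choose_mul`). [folklore] -/
theorem pb_fibre_count_mul_choose_le {j : ℕ} (F : Finset (Edge n)) (ρ : Edge n → Bool) (S : Finset (Edge n))
    (hne : ((slice n j).filter fun x => ∀ e ∈ F, x e = ρ e).Nonempty) :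
    #(((slice n j).filter fun x => ∀ e ∈ F, x e = ρ e).filter fun x => ∀ e ∈ S, x e = true) *
        (n.choose 2 - #F).choose #(S \ F) ≤
      #((slice n j).filter fun x => ∀ e ∈ F, x e = ρ e) * (j - #(F.filter fun e => ρ e = true)).choose #(S \ F) := by
  set Φ := (slice n j).filter fun x => ∀ e ∈ F, x e = ρ e with hΦ
  set r := #(F.filter fun e => ρ e = true) with hr
  set t := #(S \ F) with ht
  set M := n.choose 2 - #F with hM
  obtain ⟨x₀, hx₀⟩ := hne
  obtain ⟨hmem, hrj⟩ := pb_onSet_sdiff_mem hx₀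
  have hmmM : j - r ≤ M := by
    have h := card_le_card (mem_powersetCard.1 hmem).1
    rwa [(mem_powersetCard.1 hmem).2, card_compl, card_edgeSet_top_fin] at h
  by_cases htmm : t ≤ j - r
  · have h1 : #(Φ.filter fun x => ∀ e ∈ S, x e = true) ≤ #(Φ.filter fun x => ∀ e ∈ S \ F, x e = true) := by
      refine card_le_card fun x hx => ?_
      rw [mem_filter] at hx ⊢
      exact ⟨hx.1, fun e he => hx.2 e (mem_sdiff.1 he).1⟩
    have h2 : #(Φ.filter fun x => ∀ e ∈ S \ F, x e = true) ≤ (M - t).choose (j - r - t) :=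
      pb_card_fibre_supset_le F ρ (S \ F) (fun e he => (mem_sdiff.1 he).2) htmm
    have h3 : M.choose (j - r) ≤ #Φ := pb_le_card_fibre F ρ hrj
    have h4 : M.choose (j - r) * (j - r).choose t = M.choose t * (M - t).choose (j - r - t) := Nat.choose_mul htmm
    calc #(Φ.filter fun x => ∀ e ∈ S, x e = true) * M.choose t ≤ (M - t).choose (j - r - t) * M.choose t :=
          Nat.mul_le_mul_right _ (h1.trans h2)
      _ = M.choose (j - r) * (j - r).choose t := by rw [h4]; ring
      _ ≤ #Φ * (j - r).choose t := Nat.mul_le_mul_right _ h3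
  · have h0 : Φ.filter (fun x => ∀ e ∈ S, x e = true) = ∅ := by
      refine filter_eq_empty_iff.2 fun x hx hall => htmm ?_
      obtain ⟨hmemx, -⟩ := pb_onSet_sdiff_mem hx
      have h := card_le_card (show S \ F ⊆ onSet x \ F from fun e he =>
        mem_sdiff.2 ⟨(mem_onSet x e).2 (hall e (mem_sdiff.1 he).1), (mem_sdiff.1 he).2⟩)
      rwa [(mem_powersetCard.1 hmemx).2] at h
    rw [h0, card_empty, zero_mul]
    exact Nat.zero_le _

/-- No member of `Φ(ρ)` switches on `S` if `ρ` is off somewhere on `S ∩ F`. [folklore] -/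
theorem pb_fibre_count_eq_zero {j : ℕ} (F : Finset (Edge n)) (ρ : Edge n → Bool) (S : Finset (Edge n))
    (h : ¬ ∀ e ∈ S ∩ F, ρ e = true) :
    #(((slice n j).filter fun x => ∀ e ∈ F, x e = ρ e).filter fun x => ∀ e ∈ S, x e = true) = 0 := by
  rw [card_eq_zero, filter_eq_empty_iff]
  intro x hx hall
  refine h fun e he => ?_
  rw [mem_inter] at he
  rw [← (mem_filter.1 hx).2 e he.2]
  exact hall e he.1

/-- **The ratio form**: `c(ρ)/#Φ(ρ) ≤ [S ∩ F ⊆ ρ⁻¹(1)]·C(j - r, t)/C(#Fᶜ, t)` for every pattern `ρ` (both sides vanish on an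
empty fibre). [folklore] -/
theorem pb_fibre_count_div_le {j : ℕ} (F : Finset (Edge n)) (ρ : Edge n → Bool) (S : Finset (Edge n)) :
    (#(((slice n j).filter fun x => ∀ e ∈ F, x e = ρ e).filter fun x => ∀ e ∈ S, x e = true) : ℝ) /
        #((slice n j).filter fun x => ∀ e ∈ F, x e = ρ e) ≤
      if ∀ e ∈ S ∩ F, ρ e = true then
        (((j - #(F.filter fun e => ρ e = true)).choose #(S \ F) : ℕ) : ℝ) / ((#Fᶜ).choose #(S \ F) : ℕ)
      else 0 := by
  set Φ := (slice n j).filter fun x => ∀ e ∈ F, x e = ρ e with hΦ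
  have hM : #Fᶜ = n.choose 2 - #F := by rw [card_compl, card_edgeSet_top_fin]
  by_cases hall : ∀ e ∈ S ∩ F, ρ e = true
  · rw [if_pos hall]
    rcases Φ.eq_empty_or_nonempty with hΦe | hne
    · rw [hΦe, filter_empty, card_empty, Nat.cast_zero, zero_div]
      positivity
    · have hΦpos : (0 : ℝ) < #Φ := by exact_mod_cast hne.card_pos
      have htM : #(S \ F) ≤ #Fᶜ := card_le_card fun e he => mem_compl.2 (mem_sdiff.1 he).2
      have hCpos : (0 : ℝ) < ((#Fᶜ).choose #(S \ F) : ℕ) := by exact_mod_cast Nat.choose_pos htM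
      rw [div_le_div_iff₀ hΦpos hCpos, hM]
      have h : ((#(Φ.filter fun x => ∀ e ∈ S, x e = true) * (n.choose 2 - #F).choose #(S \ F) : ℕ) : ℝ) ≤
          ((#Φ * (j - #(F.filter fun e => ρ e = true)).choose #(S \ F) : ℕ) : ℝ) := by
        exact_mod_cast pb_fibre_count_mul_choose_le F ρ S hne
      push_cast at h
      linarith
  · rw [if_neg hall, pb_fibre_count_eq_zero F ρ S hall, Nat.cast_zero, zero_div]

/-! ## Union bounds and the fibrewise sum -/

/-- **Weighted union bound**: if every `x ∈ s` with `Q x` satisfies `P i x` for some `i ∈ I`, then for nonnegative weights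
`Σ_{x ∈ s, Q x} w x ≤ Σ_{i ∈ I} Σ_{x ∈ s, P i x} w x`. [folklore] -/
theorem pb_sum_filter_le_sum_sum {ι κ : Type*} (s : Finset ι) (I : Finset κ) (P : κ → ι → Prop) (Q : ι → Prop)
    [DecidablePred Q] [∀ i, DecidablePred (P i)] (w : ι → ℝ) (hw : ∀ x ∈ s, 0 ≤ w x)
    (hcov : ∀ x ∈ s, Q x → ∃ i ∈ I, P i x) :
    ∑ x ∈ s.filter Q, w x ≤ ∑ i ∈ I, ∑ x ∈ s.filter (P i), w x := by
  calc ∑ x ∈ s.filter Q, w x ≤ ∑ x ∈ s.filter Q, (#(I.filter fun i => P i x) : ℝ) * w x := by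
        refine sum_le_sum fun x hx => ?_
        obtain ⟨hxs, hQ⟩ := mem_filter.1 hx
        obtain ⟨i, hi, hP⟩ := hcov x hxs hQ
        have h1 : (1 : ℝ) ≤ #(I.filter fun i => P i x) := by
          exact_mod_cast card_pos.2 ⟨i, mem_filter.2 ⟨hi, hP⟩⟩
        nlinarith [hw x hxs]
    _ ≤ ∑ x ∈ s, (#(I.filter fun i => P i x) : ℝ) * w x :=
        sum_le_sum_of_subset_of_nonneg (filter_subset _ _) fun x hx _ => mul_nonneg (Nat.cast_nonneg _) (hw x hx)
    _ = ∑ x ∈ s, ∑ i ∈ I, if P i x then w x else 0 := by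
        refine sum_congr rfl fun x _ => ?_
        rw [← sum_filter, sum_const, nsmul_eq_mul]
    _ = ∑ i ∈ I, ∑ x ∈ s.filter (P i), w x := by
        rw [sum_comm]
        exact sum_congr rfl fun i _ => (sum_filter _ _).symm

/-- **The triple-sum reduction, registered form** (helper of stub B3 `stub_pairBound`): with `𝒜` the `k`-sets,
`K_A = {e : cliqueVec A e}`, `t_B = #(K_B ∖ F)`,
`Σ_ρ a(ρ)²/#Φ(ρ) ≤ Σ_{B ∈ 𝒜} Σ_{A ∈ 𝒜} Σ_{x ∈ slice_j, K_A ∪ (K_B ∩ F) ⊆ x} C(#(x ∖ F), t_B)/C(#Fᶜ, t_B)`. Steps: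
`a(ρ) ≤ Σ_B c_B(ρ)` (a clique graph contains some `K_B`), `c_B(ρ)/#Φ(ρ) ≤ [K_B ∩ F ⊆ ρ⁻¹(1)]·C(j-r, t_B)/C(#Fᶜ, t_B)`
(`pb_fibre_count_div_le`), `Σ_ρ a(ρ)·g(ρ) = Σ_{x clique} g(x|_F)` (fibrewise), union bound over the clique of `x`, and
`j - r = #(x ∖ F)` on the slice. [folklore] -/
theorem pb_replicaTripleSum :
    ∀ (n k j : ℕ) (F : Finset (Edge n)),
      ∑ ρ ∈ (slice n j).image (fun x e => if e ∈ F then x e else false),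
          (#((slice n j).filter fun x => (∀ e ∈ F, x e = ρ e) ∧ cliqueFn n k x = true) : ℝ) ^ 2 /
            #((slice n j).filter fun x => ∀ e ∈ F, x e = ρ e) ≤
        ∑ B ∈ powersetCard k (univ : Finset (Fin n)), ∑ A ∈ powersetCard k (univ : Finset (Fin n)),
          ∑ x ∈ (slice n j).filter (fun x => ∀ e ∈ (univ.filter fun e : Edge n => cliqueVec A e = true) ∪
              ((univ.filter fun e : Edge n => cliqueVec B e = true) ∩ F), x e = true),
            (((#(onSet x \ F)).choose #((univ.filter fun e : Edge n => cliqueVec B e = true) \ F) : ℕ) : ℝ) /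
              ((#Fᶜ).choose #((univ.filter fun e : Edge n => cliqueVec B e = true) \ F) : ℕ) := by
  intro n k j F
  set 𝒜 := powersetCard k (univ : Finset (Fin n)) with h𝒜
  set pat : (Edge n → Bool) → (Edge n → Bool) := fun x e => if e ∈ F then x e else false with hpat
  set Sv : Finset (Fin n) → Finset (Edge n) := fun A => univ.filter fun e : Edge n => cliqueVec A e = true with hSv
  set C := (slice n j).filter fun x => cliqueFn n k x = true with hC
  set G : Finset (Fin n) → (Edge n → Bool) → ℝ := fun B ρ =>
    if ∀ e ∈ Sv B ∩ F, ρ e = true then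
      (((j - #(F.filter fun e => ρ e = true)).choose #(Sv B \ F) : ℕ) : ℝ) / ((#Fᶜ).choose #(Sv B \ F) : ℕ)
    else 0 with hG
  have hG0 : ∀ B ρ, 0 ≤ G B ρ := fun B ρ => by
    simp only [hG]
    split_ifs
    · positivity
    · exact le_rfl
  -- a clique graph contains the clique edge set of some `k`-set
  have hcov : ∀ x : Edge n → Bool, cliqueFn n k x = true → ∃ B ∈ 𝒜, ∀ e ∈ Sv B, x e = true := by
    intro x hcl
    have hne := (cliqueCount_ne_zero_iff x).2 hcl
    rw [Ne, cliqueCount_eq_zero_iff_forall] at hne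
    push Not at hne
    obtain ⟨B, hB, hBx⟩ := hne
    exact ⟨B, hB, fun e he => hBx e (mem_filter.1 he).2⟩
  -- Step 1: `a(ρ)²/#Φ(ρ) ≤ a(ρ)·Σ_B G_B(ρ)`
  have step1 : ∀ ρ : Edge n → Bool,
      (#((slice n j).filter fun x => (∀ e ∈ F, x e = ρ e) ∧ cliqueFn n k x = true) : ℝ) ^ 2 /
          #((slice n j).filter fun x => ∀ e ∈ F, x e = ρ e) ≤
        (#((slice n j).filter fun x => (∀ e ∈ F, x e = ρ e) ∧ cliqueFn n k x = true) : ℝ) * ∑ B ∈ 𝒜, G B ρ := by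
    intro ρ
    set Φ := (slice n j).filter fun x => ∀ e ∈ F, x e = ρ e with hΦ
    set a := #((slice n j).filter fun x => (∀ e ∈ F, x e = ρ e) ∧ cliqueFn n k x = true) with ha
    have hub : a ≤ ∑ B ∈ 𝒜, #(Φ.filter fun x => ∀ e ∈ Sv B, x e = true) := by
      calc a ≤ #(𝒜.biUnion fun B => Φ.filter fun x => ∀ e ∈ Sv B, x e = true) := by
            refine card_le_card fun x hx => ?_
            obtain ⟨hxs, hxρ, hcl⟩ := mem_filter.1 hx
            obtain ⟨B, hB, hBx⟩ := hcov x hcl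
            exact mem_biUnion.2 ⟨B, hB, mem_filter.2 ⟨mem_filter.2 ⟨hxs, hxρ⟩, hBx⟩⟩
        _ ≤ _ := card_biUnion_le
    have hGB : ∀ B ∈ 𝒜, (#(Φ.filter fun x => ∀ e ∈ Sv B, x e = true) : ℝ) / #Φ ≤ G B ρ :=
      fun B _ => pb_fibre_count_div_le F ρ (Sv B)
    calc (a : ℝ) ^ 2 / #Φ = (a : ℝ) * ((a : ℝ) / #Φ) := by rw [sq, mul_div_assoc]
      _ ≤ (a : ℝ) * (((∑ B ∈ 𝒜, #(Φ.filter fun x => ∀ e ∈ Sv B, x e = true) : ℕ) : ℝ) / #Φ) :=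
          mul_le_mul_of_nonneg_left (div_le_div_of_nonneg_right (by exact_mod_cast hub) (Nat.cast_nonneg _))
            (Nat.cast_nonneg _)
      _ = (a : ℝ) * ∑ B ∈ 𝒜, (#(Φ.filter fun x => ∀ e ∈ Sv B, x e = true) : ℝ) / #Φ := by
          rw [Nat.cast_sum, sum_div]
      _ ≤ (a : ℝ) * ∑ B ∈ 𝒜, G B ρ := mul_le_mul_of_nonneg_left (sum_le_sum hGB) (Nat.cast_nonneg _)
  -- Step 2: the fibrewise sum `Σ_ρ a(ρ)·g(ρ) = Σ_{x clique} g(x)`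
  have hpatF : ∀ x : Edge n → Bool, ∀ e ∈ F, pat x e = x e := fun x e he => by simp [hpat, he]
  have hfib : ∀ ρ ∈ (slice n j).image pat, ∀ x : Edge n → Bool, ((∀ e ∈ F, x e = ρ e) ↔ pat x = ρ) := by
    intro ρ hρ x
    obtain ⟨x₀, -, rfl⟩ := mem_image.1 hρ
    constructor
    · intro h
      funext e
      by_cases he : e ∈ F
      · rw [hpatF x e he, h e he]
      · simp [hpat, he]
    · intro h e he
      rw [← h, hpatF x e he]
  have hGpat : ∀ B x, G B (pat x) = G B x := by
    intro B x
    have h1 : (∀ e ∈ Sv B ∩ F, pat x e = true) ↔ (∀ e ∈ Sv B ∩ F, x e = true) :=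
      forall₂_congr fun e he => by rw [hpatF x e (mem_inter.1 he).2]
    have h2 : F.filter (fun e => pat x e = true) = F.filter (fun e => x e = true) :=
      filter_congr fun e he => by rw [hpatF x e he]
    simp only [hG]
    by_cases hc : ∀ e ∈ Sv B ∩ F, x e = true
    · rw [if_pos hc, if_pos (h1.2 hc), h2]
    · rw [if_neg hc, if_neg (mt h1.1 hc)]
  have step2 : ∑ ρ ∈ (slice n j).image pat,
      (#((slice n j).filter fun x => (∀ e ∈ F, x e = ρ e) ∧ cliqueFn n k x = true) : ℝ) * ∑ B ∈ 𝒜, G B ρ =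
        ∑ x ∈ C, ∑ B ∈ 𝒜, G B x := by
    have hmaps : ∀ x ∈ C, pat x ∈ (slice n j).image pat := fun x hx => mem_image_of_mem _ (mem_filter.1 hx).1
    calc ∑ ρ ∈ (slice n j).image pat,
          (#((slice n j).filter fun x => (∀ e ∈ F, x e = ρ e) ∧ cliqueFn n k x = true) : ℝ) * ∑ B ∈ 𝒜, G B ρ
        = ∑ ρ ∈ (slice n j).image pat, ∑ x ∈ C with pat x = ρ, ∑ B ∈ 𝒜, G B ρ := by
          refine sum_congr rfl fun ρ hρ => ?_
          rw [sum_const, nsmul_eq_mul]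
          congr 2
          rw [hC, filter_filter]
          congr 1
          refine filter_congr fun x _ => ?_
          rw [hfib ρ hρ x]
          tauto
      _ = ∑ x ∈ C, ∑ B ∈ 𝒜, G B (pat x) := sum_fiberwise_of_maps_to' hmaps _
      _ = ∑ x ∈ C, ∑ B ∈ 𝒜, G B x := sum_congr rfl fun x _ => sum_congr rfl fun B _ => hGpat B x
  -- Step 3: second union bound (over the clique of `x`)
  have step3 : ∀ B ∈ 𝒜, ∑ x ∈ C, G B x ≤
      ∑ A ∈ 𝒜, ∑ x ∈ (slice n j).filter (fun x => ∀ e ∈ Sv A, x e = true), G B x := by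
    intro B _
    exact pb_sum_filter_le_sum_sum (slice n j) 𝒜 (fun A x => ∀ e ∈ Sv A, x e = true)
      (fun x => cliqueFn n k x = true) (G B) (fun x _ => hG0 B x) (fun x _ hx => hcov x hx)
  -- Step 4: `G_B` on the slice: `j - r = #(x ∖ F)`
  have step4 : ∀ A B, ∑ x ∈ (slice n j).filter (fun x => ∀ e ∈ Sv A, x e = true), G B x =
      ∑ x ∈ (slice n j).filter (fun x => ∀ e ∈ Sv A ∪ (Sv B ∩ F), x e = true),
        (((#(onSet x \ F)).choose #(Sv B \ F) : ℕ) : ℝ) / ((#Fᶜ).choose #(Sv B \ F) : ℕ) := by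
    intro A B
    simp only [hG]
    rw [← sum_filter, filter_filter]
    have hset : (slice n j).filter (fun x => (∀ e ∈ Sv A, x e = true) ∧ ∀ e ∈ Sv B ∩ F, x e = true) =
        (slice n j).filter (fun x => ∀ e ∈ Sv A ∪ (Sv B ∩ F), x e = true) := by
      refine filter_congr fun x _ => ?_
      simp only [mem_union]
      exact ⟨fun h e he => he.elim (h.1 e) (h.2 e), fun h => ⟨fun e he => h e (Or.inl he), fun e he => h e (Or.inr he)⟩⟩
    rw [hset]
    refine sum_congr rfl fun x hx => ?_
    have hxs : x ∈ slice n j := (mem_filter.1 hx).1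
    have hcard := card_sdiff_add_card_inter (onSet x) F
    rw [pb_onSet_inter_eq (F := F) (ρ := x) (fun e _ => rfl), show #(onSet x) = edgeCount x from rfl,
      pb_mem_slice_iff.1 hxs] at hcard
    rw [show j - #(F.filter fun e => x e = true) = #(onSet x \ F) by omega]
  -- assemble
  calc ∑ ρ ∈ (slice n j).image pat,
        (#((slice n j).filter fun x => (∀ e ∈ F, x e = ρ e) ∧ cliqueFn n k x = true) : ℝ) ^ 2 /
          #((slice n j).filter fun x => ∀ e ∈ F, x e = ρ e)
      ≤ ∑ ρ ∈ (slice n j).image pat,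
          (#((slice n j).filter fun x => (∀ e ∈ F, x e = ρ e) ∧ cliqueFn n k x = true) : ℝ) * ∑ B ∈ 𝒜, G B ρ :=
        sum_le_sum fun ρ _ => step1 ρ
    _ = ∑ x ∈ C, ∑ B ∈ 𝒜, G B x := step2
    _ = ∑ B ∈ 𝒜, ∑ x ∈ C, G B x := sum_comm
    _ ≤ ∑ B ∈ 𝒜, ∑ A ∈ 𝒜, ∑ x ∈ (slice n j).filter (fun x => ∀ e ∈ Sv A, x e = true), G B x := sum_le_sum step3
    _ = _ := sum_congr rfl fun B _ => sum_congr rfl fun A _ => step4 A B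

end
end A2
section MineB3
open Literature.Computability.Complexity Finset Filter Classical
open scoped Topology
open Summit.PneNP.PneNP.Theorems.ConstantBand.Negative (Edge thr Central slice)
open Summit.PneNP.PneNP.Theorems.SliceACZero.Negative (choose_mul_ratio_pow_le')
open Summit.PneNP.PneNP.Cruxes.ConstantBand.FlatPriorRelativeMinterms (ts_tendsto_T ts_T_mul_lower_le ts_le_T_mul_upper
  ts_tendsto_lower ts_tendsto_upper ts_central_iff)

noncomputable section

/-- The clique edge set `K_A = {e : cliqueVec A e}` has `C(#A, 2)` elements. [folklore] -/
private theorem lpb_card_cliqueEdges {n : ℕ} (A : Finset (Fin n)) :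
    #(univ.filter fun e : Edge n => cliqueVec A e = true) = (#A).choose 2 :=
  card_filter_cliqueVec A

/-- **The exponent inequality**: `#(K_A ∪ (K_B ∩ F)) + #(K_B ∖ F) ≥ #(K_A ∪ K_B)`. [folklore] -/
private theorem lpb_exp_ge {n : ℕ} (SA SB F : Finset (Edge n)) :
    #(SA ∪ SB) ≤ #(SA ∪ (SB ∩ F)) + #(SB \ F) := by
  calc #(SA ∪ SB) ≤ #((SA ∪ (SB ∩ F)) ∪ (SB \ F)) := by
        refine card_le_card fun e he => ?_
        rw [Finset.mem_union] at he
        rw [Finset.mem_union, Finset.mem_union, Finset.mem_inter, Finset.mem_sdiff]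
        rcases he with h | h
        · exact Or.inl (Or.inl h)
        · by_cases hf : e ∈ F
          · exact Or.inl (Or.inr ⟨h, hf⟩)
          · exact Or.inr ⟨h, hf⟩
    _ ≤ #(SA ∪ (SB ∩ F)) + #(SB \ F) := card_union_le _ _

/-- **The diagonal exponent**: `#(K_B ∪ (K_B ∩ F)) + #(K_B ∖ F) = #K_B + #(K_B ∖ F)`. [folklore] -/
private theorem lpb_exp_diag {n : ℕ} (SB F : Finset (Edge n)) :
    #(SB ∪ (SB ∩ F)) + #(SB \ F) = #SB + #(SB \ F) := by
  rw [union_eq_left.2 inter_subset_left]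

/-- **Overlap sum around a fixed `k`-set** (`q ≥ 0`): `Σ_{A ≠ B} q^{K - C(#(A∩B),2)} ≤ C(n,k)·q^K + R(q)`,
`R(q) = Σ_{i=2}^{k-1} C(k,i)C(n,k-i) q^{K - C(i,2)}` — the `A` with `#(A ∩ B) ≤ 1` are edge-disjoint from `B`
(exponent `K`), the others have `2 ≤ #(A∩B) ≤ k-1` (`pb_card_inter_lt_of_ne`, `pb_card_filter_card_inter_eq_le`). [folklore] -/
private theorem lpb_sum_pow_le {n k : ℕ} {B : Finset (Fin n)} (hB : B ∈ powersetCard k (univ : Finset (Fin n))) {q : ℝ}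
    (hq : 0 ≤ q) :
    ∑ A ∈ (powersetCard k (univ : Finset (Fin n))).filter (fun A => A ≠ B), q ^ (k.choose 2 - (#(A ∩ B)).choose 2) ≤
      (n.choose k : ℝ) * q ^ k.choose 2 +
        ∑ i ∈ Ico 2 k, ((k.choose i * n.choose (k - i) : ℕ) : ℝ) * q ^ (k.choose 2 - i.choose 2) := by
  -- adapted from Theorems/OneSliceSliceTargetCliqueDensityLower.lean (`cdl_sum_ite_pow_le`)
  set 𝒜 := powersetCard k (univ : Finset (Fin n)) with h𝒜
  have hBk : #B = k := (mem_powersetCard.1 hB).2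
  rw [← sum_filter_add_sum_filter_not (𝒜.filter fun A => A ≠ B) (fun A => #(A ∩ B) ≤ 1)]
  refine add_le_add ?_ ?_
  · calc ∑ A ∈ (𝒜.filter fun A => A ≠ B).filter (fun A => #(A ∩ B) ≤ 1), q ^ (k.choose 2 - (#(A ∩ B)).choose 2)
        = ∑ A ∈ (𝒜.filter fun A => A ≠ B).filter (fun A => #(A ∩ B) ≤ 1), q ^ k.choose 2 := by
          refine sum_congr rfl fun A hA => ?_
          rw [Nat.choose_eq_zero_of_lt (show #(A ∩ B) < 2 by have := (mem_filter.1 hA).2; omega), Nat.sub_zero]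
      _ ≤ (#𝒜 : ℝ) * q ^ k.choose 2 := by
          rw [sum_const, nsmul_eq_mul]
          gcongr
          exact (filter_subset _ _).trans (filter_subset _ _)
      _ = (n.choose k : ℝ) * q ^ k.choose 2 := by rw [h𝒜, card_powersetCard, card_univ, Fintype.card_fin]
  · have hmaps : ∀ A ∈ 𝒜.filter (fun A => #(A ∩ B) ∈ Ico 2 k), (fun A => #(A ∩ B)) A ∈ Ico 2 k :=
      fun A hA => (mem_filter.1 hA).2
    calc ∑ A ∈ (𝒜.filter fun A => A ≠ B).filter (fun A => ¬ #(A ∩ B) ≤ 1), q ^ (k.choose 2 - (#(A ∩ B)).choose 2)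
        ≤ ∑ A ∈ 𝒜.filter (fun A => #(A ∩ B) ∈ Ico 2 k), q ^ (k.choose 2 - (#(A ∩ B)).choose 2) := by
          refine sum_le_sum_of_subset_of_nonneg (fun A hA => ?_) (fun _ _ _ => pow_nonneg hq _)
          simp only [mem_filter, mem_Ico] at hA ⊢
          have hlt : #(B ∩ A) < k := pb_card_inter_lt_of_ne hB hA.1.1 (Ne.symm hA.1.2)
          rw [inter_comm] at hlt
          exact ⟨hA.1.1, by omega, hlt⟩
      _ = ∑ i ∈ Ico 2 k, ∑ A ∈ (𝒜.filter (fun A => #(A ∩ B) ∈ Ico 2 k)).filter (fun A => #(A ∩ B) = i),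
            q ^ (k.choose 2 - i.choose 2) := (sum_fiberwise_of_maps_to' hmaps (fun i => q ^ (k.choose 2 - i.choose 2))).symm
      _ ≤ ∑ i ∈ Ico 2 k, ((k.choose i * n.choose (k - i) : ℕ) : ℝ) * q ^ (k.choose 2 - i.choose 2) := by
          refine sum_le_sum fun i _ => ?_
          rw [sum_const, nsmul_eq_mul, filter_filter]
          refine mul_le_mul_of_nonneg_right ?_ (pow_nonneg hq _)
          have hsub : ((𝒜.filter fun A => #(A ∩ B) ∈ Ico 2 k ∧ #(A ∩ B) = i)) ⊆ 𝒜.filter fun A => #(B ∩ A) = i := by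
            intro A hA
            simp only [mem_filter] at hA ⊢
            rw [inter_comm]
            exact ⟨hA.1, hA.2.2⟩
          exact_mod_cast (card_le_card hsub).trans (pb_card_filter_card_inter_eq_le hBk i)

/-- **The deterministic pair bound.** For `k ≥ 2`, `1 ≤ K = C(k,2)`, `4K ≤ j ≤ N = C(n,2)`, `4K ≤ N`, a read set `F` with
`2·#F ≤ N`, `q = j/N`, `μ = C(n,k) q^K`, `R = Σ_{i=2}^{k-1} C(k,i)C(n,k-i) q^{K-C(i,2)}`:
`Σ_Φ a_Φ²/#Φ ≤ (1 + 4^{K+1}K²/j)·((#F/N)·μ + q·μ + μ·(μ + R))·#slice_j`. [folklore] -/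
theorem lpb_pairBound_det {n k j : ℕ} (hk : 2 ≤ k) (F : Finset (Edge n)) (hKN : 4 * k.choose 2 ≤ n.choose 2)
    (hKj : 4 * k.choose 2 ≤ j) (hjN : j ≤ n.choose 2) (h2F : 2 * #F ≤ n.choose 2) :
    ∑ ρ ∈ (slice n j).image (fun x e => if e ∈ F then x e else false),
        (#((slice n j).filter fun x => (∀ e ∈ F, x e = ρ e) ∧ cliqueFn n k x = true) : ℝ) ^ 2 /
          #((slice n j).filter fun x => ∀ e ∈ F, x e = ρ e) ≤
      (1 + 4 ^ (k.choose 2 + 1) * (k.choose 2 : ℝ) ^ 2 / j) *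
        ((#F : ℝ) / (n.choose 2 : ℕ) * ((n.choose k : ℝ) * ((j : ℝ) / (n.choose 2 : ℕ)) ^ k.choose 2) +
          (j : ℝ) / (n.choose 2 : ℕ) * ((n.choose k : ℝ) * ((j : ℝ) / (n.choose 2 : ℕ)) ^ k.choose 2) +
          ((n.choose k : ℝ) * ((j : ℝ) / (n.choose 2 : ℕ)) ^ k.choose 2) *
            (((n.choose k : ℝ) * ((j : ℝ) / (n.choose 2 : ℕ)) ^ k.choose 2) +
              ∑ i ∈ Ico 2 k, ((k.choose i * n.choose (k - i) : ℕ) : ℝ) *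
                ((j : ℝ) / (n.choose 2 : ℕ)) ^ (k.choose 2 - i.choose 2))) * #(slice n j) := by
  set 𝒜 := powersetCard k (univ : Finset (Fin n)) with h𝒜
  set N := n.choose 2 with hNdef
  set K := k.choose 2 with hKdef
  set q : ℝ := (j : ℝ) / (N : ℕ) with hq
  set S : ℝ := (#(slice n j) : ℝ) with hSdef
  set c : ℝ := 1 + 4 ^ (K + 1) * (K : ℝ) ^ 2 / j with hc
  set Sv : Finset (Fin n) → Finset (Edge n) := fun A => univ.filter fun e : Edge n => cliqueVec A e = true with hSv
  set μ : ℝ := (n.choose k : ℝ) * q ^ K with hμ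
  set R : ℝ := ∑ i ∈ Ico 2 k, ((k.choose i * n.choose (k - i) : ℕ) : ℝ) * q ^ (K - i.choose 2) with hR
  have hK1 : 1 ≤ K := by rw [hKdef]; exact Nat.choose_pos hk
  have hN : 0 < N := by omega
  have hNr : (0 : ℝ) < (N : ℕ) := by exact_mod_cast hN
  have hj0 : (0 : ℝ) < j := by exact_mod_cast (show 0 < j by omega)
  have hq0 : 0 ≤ q := div_nonneg (Nat.cast_nonneg _) hNr.le
  have hq1 : q ≤ 1 := by rw [hq, div_le_one hNr]; exact_mod_cast hjN
  have hS0 : 0 ≤ S := Nat.cast_nonneg _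
  have hc1 : 1 ≤ c := by rw [hc]; exact le_add_of_nonneg_right (by positivity)
  have hc0 : 0 ≤ c := zero_le_one.trans hc1
  have hμ0 : 0 ≤ μ := by positivity
  have hR0 : 0 ≤ R := sum_nonneg fun i _ => mul_nonneg (Nat.cast_nonneg _) (pow_nonneg hq0 _)
  have hSvk : ∀ A ∈ 𝒜, #(Sv A) = K := fun A hA => by rw [hSv, lpb_card_cliqueEdges, (mem_powersetCard.1 hA).2]
  -- Step 1: Aux II and Aux I
  have step1 := pb_replicaTripleSum n k j F
  have hterm : ∀ B ∈ 𝒜, ∀ A ∈ 𝒜,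
      ∑ x ∈ (slice n j).filter (fun x => ∀ e ∈ Sv A ∪ (Sv B ∩ F), x e = true),
          (((#(onSet x \ F)).choose #(Sv B \ F) : ℕ) : ℝ) / ((#Fᶜ).choose #(Sv B \ F) : ℕ) ≤
        c * q ^ (#(Sv A ∪ (Sv B ∩ F)) + #(Sv B \ F)) * S := by
    intro B hB A hA
    have htK : #(Sv B \ F) ≤ K := (card_le_card sdiff_subset).trans (hSvk B hB).le
    have hD : #(Sv A ∪ (Sv B ∩ F)) ≤ 2 * K := by
      calc #(Sv A ∪ (Sv B ∩ F)) ≤ #(Sv A) + #(Sv B ∩ F) := card_union_le _ _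
        _ ≤ K + K := add_le_add (hSvk A hA).le ((card_le_card inter_subset_left).trans (hSvk B hB).le)
        _ = 2 * K := by ring
    exact pb_pairTermCount n j K _ F _ htK hD hK1 hKN hKj hjN h2F
  -- Step 2: the exponents
  have hexp : ∀ B ∈ 𝒜, ∀ A ∈ 𝒜, q ^ (#(Sv A ∪ (Sv B ∩ F)) + #(Sv B \ F)) ≤
      (if A ≠ B then q ^ K * q ^ (K - (#(A ∩ B)).choose 2) else q ^ K * (if #(Sv B \ F) = 0 then 1 else q)) := by
    intro B hB A hA
    by_cases hAB : A ≠ B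
    · rw [if_pos hAB, ← pow_add]
      refine pow_le_pow_of_le_one hq0 hq1 ?_
      have hunion : #(Sv A ∪ Sv B) + (#(A ∩ B)).choose 2 = K + K := by
        have h := pb_card_cliqueEdges_union_add (n := n) A B
        rw [(mem_powersetCard.1 hA).2, (mem_powersetCard.1 hB).2] at h
        exact h
      have h1 := lpb_exp_ge (Sv A) (Sv B) F
      have hg : (#(A ∩ B)).choose 2 ≤ K := by
        rw [hKdef]
        exact Nat.choose_le_choose 2 ((card_le_card inter_subset_left).trans (mem_powersetCard.1 hA).2.le)
      omega
    · rw [if_neg hAB]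
      push Not at hAB
      subst hAB
      rw [lpb_exp_diag, hSvk A hA, pow_add]
      refine mul_le_mul_of_nonneg_left ?_ (pow_nonneg hq0 _)
      by_cases ht : #(Sv A \ F) = 0
      · rw [if_pos ht, ht, pow_zero]
      · rw [if_neg ht]
        calc q ^ #(Sv A \ F) ≤ q ^ 1 := pow_le_pow_of_le_one hq0 hq1 (Nat.one_le_iff_ne_zero.2 ht)
          _ = q := pow_one q
  -- Step 3: sum over A for fixed B
  have hinner : ∀ B ∈ 𝒜, ∑ A ∈ 𝒜, q ^ (#(Sv A ∪ (Sv B ∩ F)) + #(Sv B \ F)) ≤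
      q ^ K * (if #(Sv B \ F) = 0 then 1 else q) + q ^ K * (μ + R) := by
    intro B hB
    calc ∑ A ∈ 𝒜, q ^ (#(Sv A ∪ (Sv B ∩ F)) + #(Sv B \ F))
        ≤ ∑ A ∈ 𝒜, (if A ≠ B then q ^ K * q ^ (K - (#(A ∩ B)).choose 2)
            else q ^ K * (if #(Sv B \ F) = 0 then 1 else q)) := sum_le_sum (hexp B hB)
      _ = ∑ A ∈ 𝒜.filter (fun A => A ≠ B), q ^ K * q ^ (K - (#(A ∩ B)).choose 2) +
          ∑ A ∈ 𝒜.filter (fun A => ¬ A ≠ B), q ^ K * (if #(Sv B \ F) = 0 then 1 else q) := by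
          rw [← sum_filter_add_sum_filter_not 𝒜 (fun A => A ≠ B)]
          congr 1
          · exact sum_congr rfl fun A hA => if_pos (mem_filter.1 hA).2
          · exact sum_congr rfl fun A hA => if_neg (mem_filter.1 hA).2
      _ ≤ q ^ K * (μ + R) + q ^ K * (if #(Sv B \ F) = 0 then 1 else q) := by
          refine add_le_add ?_ ?_
          · rw [← mul_sum]
            exact mul_le_mul_of_nonneg_left (lpb_sum_pow_le hB hq0) (pow_nonneg hq0 _)
          · have hfil : 𝒜.filter (fun A => ¬ A ≠ B) = {B} := by
              ext A
              simp only [mem_filter, mem_singleton, not_not]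
              exact ⟨fun h => h.2, fun h => ⟨h ▸ hB, h⟩⟩
            rw [hfil, sum_singleton]
      _ = _ := by ring
  -- Step 4: sum over B: the diagonal counts
  have hdiag : ∑ B ∈ 𝒜, q ^ K * (if #(Sv B \ F) = 0 then (1 : ℝ) else q) ≤ (#F : ℝ) / (N : ℕ) * μ + q * μ := by
    have hsplit : ∑ B ∈ 𝒜, q ^ K * (if #(Sv B \ F) = 0 then (1 : ℝ) else q) =
        q ^ K * #(𝒜.filter fun B => #(Sv B \ F) = 0) + q ^ K * q * #(𝒜.filter fun B => ¬ #(Sv B \ F) = 0) := by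
      rw [← sum_filter_add_sum_filter_not 𝒜 (fun B => #(Sv B \ F) = 0)]
      have e1 : ∑ B ∈ 𝒜.filter (fun B => #(Sv B \ F) = 0), q ^ K * (if #(Sv B \ F) = 0 then (1 : ℝ) else q) =
          ∑ B ∈ 𝒜.filter (fun B => #(Sv B \ F) = 0), q ^ K :=
        sum_congr rfl fun B hB => by rw [if_pos (mem_filter.1 hB).2, mul_one]
      have e2 : ∑ B ∈ 𝒜.filter (fun B => ¬ #(Sv B \ F) = 0), q ^ K * (if #(Sv B \ F) = 0 then (1 : ℝ) else q) =
          ∑ B ∈ 𝒜.filter (fun B => ¬ #(Sv B \ F) = 0), q ^ K * q :=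
        sum_congr rfl fun B hB => by rw [if_neg (mem_filter.1 hB).2]
      rw [e1, e2, sum_const, sum_const, nsmul_eq_mul, nsmul_eq_mul]
      ring
    rw [hsplit]
    have hF' : #F ≤ N := by omega
    have hcount := pb_card_filter_cliqueEdges_subset_mul_le hk F hF'
    have hcount' : (#(𝒜.filter fun B => #(Sv B \ F) = 0) : ℝ) ≤ (#F : ℝ) / (N : ℕ) * (n.choose k : ℝ) := by
      rw [div_mul_eq_mul_div, le_div_iff₀ hNr]
      have : ((N * #(𝒜.filter fun B => #(Sv B \ F) = 0) : ℕ) : ℝ) ≤ ((#F * n.choose k : ℕ) : ℝ) := by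
        exact_mod_cast hcount
      push_cast at this
      linarith
    have hrest : (#(𝒜.filter fun B => ¬ #(Sv B \ F) = 0) : ℝ) ≤ (n.choose k : ℝ) := by
      have h : #(𝒜.filter fun B => ¬ #(Sv B \ F) = 0) ≤ #𝒜 := card_le_card (filter_subset _ _)
      rw [h𝒜, card_powersetCard, card_univ, Fintype.card_fin] at h
      exact_mod_cast h
    have hqK : 0 ≤ q ^ K := pow_nonneg hq0 _
    calc q ^ K * (#(𝒜.filter fun B => #(Sv B \ F) = 0) : ℝ) + q ^ K * q * #(𝒜.filter fun B => ¬ #(Sv B \ F) = 0)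
        ≤ q ^ K * ((#F : ℝ) / (N : ℕ) * (n.choose k : ℝ)) + q ^ K * q * (n.choose k : ℝ) :=
          add_le_add (mul_le_mul_of_nonneg_left hcount' hqK) (mul_le_mul_of_nonneg_left hrest (mul_nonneg hqK hq0))
      _ = (#F : ℝ) / (N : ℕ) * μ + q * μ := by rw [hμ]; ring
  have houter : ∑ B ∈ 𝒜, ∑ A ∈ 𝒜, q ^ (#(Sv A ∪ (Sv B ∩ F)) + #(Sv B \ F)) ≤
      (#F : ℝ) / (N : ℕ) * μ + q * μ + μ * (μ + R) := by
    calc ∑ B ∈ 𝒜, ∑ A ∈ 𝒜, q ^ (#(Sv A ∪ (Sv B ∩ F)) + #(Sv B \ F))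
        ≤ ∑ B ∈ 𝒜, (q ^ K * (if #(Sv B \ F) = 0 then 1 else q) + q ^ K * (μ + R)) := sum_le_sum hinner
      _ = ∑ B ∈ 𝒜, q ^ K * (if #(Sv B \ F) = 0 then (1 : ℝ) else q) + (#𝒜 : ℝ) * (q ^ K * (μ + R)) := by
          rw [sum_add_distrib, sum_const, nsmul_eq_mul]
      _ ≤ (#F : ℝ) / (N : ℕ) * μ + q * μ + (n.choose k : ℝ) * (q ^ K * (μ + R)) := by
          rw [h𝒜, card_powersetCard, card_univ, Fintype.card_fin]
          linarith [hdiag]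
      _ = _ := by rw [hμ]; ring
  -- Step 5: combine
  calc _ ≤ _ := step1
    _ ≤ ∑ B ∈ 𝒜, ∑ A ∈ 𝒜, c * q ^ (#(Sv A ∪ (Sv B ∩ F)) + #(Sv B \ F)) * S :=
        sum_le_sum fun B hB => sum_le_sum fun A hA => hterm B hB A hA
    _ = c * (∑ B ∈ 𝒜, ∑ A ∈ 𝒜, q ^ (#(Sv A ∪ (Sv B ∩ F)) + #(Sv B \ F))) * S := by
        rw [mul_sum, sum_mul]
        refine sum_congr rfl fun B _ => ?_
        rw [mul_sum, sum_mul]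
    _ ≤ c * ((#F : ℝ) / (N : ℕ) * μ + q * μ + μ * (μ + R)) * S :=
        mul_le_mul_of_nonneg_right (mul_le_mul_of_nonneg_left houter hc0) hS0

/-- **B3 `PairBound`** (registered statement of line `Sketch-ideator3-r1`, crux stmt-PneNP-2832): for `k ≥ 3` and `ε > 0`,
eventually in `n`, on every central slice `j`, for every read set `F` with `2·#F ≤ C(n,2)`:
`Σ_Φ a_Φ²/#Φ ≤ ((1/k!)² + (1/k!)·#F/C(n,2) + ε)·#slice_j`. [folklore] -/
theorem stub_pairBound :
    ∀ k : ℕ, 3 ≤ k → ∀ ε : ℝ, 0 < ε → ∀ᶠ n : ℕ in atTop, ∀ j : ℕ, Central k n j →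
      ∀ F : Finset (Edge n), 2 * #F ≤ n.choose 2 →
        ∑ ρ ∈ (slice n j).image (fun x e => if e ∈ F then x e else false),
            (#((slice n j).filter fun x => (∀ e ∈ F, x e = ρ e) ∧ cliqueFn n k x = true) : ℝ) ^ 2 /
              #((slice n j).filter fun x => ∀ e ∈ F, x e = ρ e) ≤
          ((1 / (k.factorial : ℝ)) ^ 2 + 1 / (k.factorial : ℝ) * (#F / (n.choose 2 : ℕ)) + ε) * #(slice n j) := by
  intro k hk ε hε
  obtain ⟨hk2, hk1r⟩ : 2 ≤ k ∧ (1 : ℝ) < k := ⟨by omega, by exact_mod_cast (show 1 < k by omega)⟩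
  set lam : ℝ := 1 / (k.factorial : ℝ) with hlam
  have hlam0 : 0 < lam := by positivity
  -- threshold density `p`, scale `T = C(n,2) p`, window factor `up`, overlap error `R`, `1/j`-correction `cc`
  obtain ⟨p, hp⟩ : ∃ p : ℕ → ℝ, ∀ n : ℕ, p n = (n : ℝ) ^ (-(2 : ℝ) / ((k : ℝ) - 1)) := ⟨_, fun _ => rfl⟩
  obtain ⟨T, hT⟩ : ∃ T : ℕ → ℝ, ∀ n : ℕ, T n = ((n.choose 2 : ℕ) : ℝ) * p n := ⟨_, fun _ => rfl⟩
  obtain ⟨up, hup⟩ : ∃ up : ℕ → ℝ, ∀ n : ℕ, up n = 1 + (T n) ^ (-(1 / 4 : ℝ)) + ((0 : ℕ) : ℝ) / T n :=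
    ⟨_, fun _ => rfl⟩
  obtain ⟨R, hR⟩ : ∃ R : ℕ → ℝ, ∀ n : ℕ, R n =
      ∑ i ∈ Ico 2 k, ((k.choose i * n.choose (k - i) : ℕ) : ℝ) * (2 * p n) ^ (k.choose 2 - i.choose 2) := ⟨_, fun _ => rfl⟩
  obtain ⟨cc, hcc⟩ : ∃ cc : ℕ → ℝ, ∀ n : ℕ, cc n = 1 + 4 ^ (k.choose 2 + 1) * (k.choose 2 : ℝ) ^ 2 * (2 / T n) :=
    ⟨_, fun _ => rfl⟩
  have hp0 : ∀ n : ℕ, 0 ≤ p n := fun n => by rw [hp n]; exact Real.rpow_nonneg (Nat.cast_nonneg _) _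
  have hplim : Tendsto p atTop (𝓝 0) := (tendsto_rpow_threshold hk2).congr fun n => (hp n).symm
  have hTlim : Tendsto T atTop atTop := (ts_tendsto_T hk).congr fun n => by rw [hT n, hp n]
  have huplim : Tendsto up atTop (𝓝 1) := (ts_tendsto_upper hTlim 0).congr fun n => (hup n).symm
  have hcclim : Tendsto cc atTop (𝓝 1) := by
    have h := (tendsto_const_nhds (x := (4 : ℝ) ^ (k.choose 2 + 1) * (k.choose 2 : ℝ) ^ 2)).mul
      ((tendsto_const_nhds (x := (2 : ℝ))).div_atTop hTlim)
    rw [mul_zero] at h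
    have h2 := (tendsto_const_nhds (x := (1 : ℝ))).add h
    rw [add_zero] at h2
    exact h2.congr fun n => (hcc n).symm
  -- `R → 0` (adapted from Theorems/OneSliceSliceTargetCliqueDensityLower.lean)
  have hRlim : Tendsto R atTop (𝓝 0) := by
    have hterm : ∀ i ∈ Ico 2 k, Tendsto (fun n : ℕ =>
        ((k.choose i * n.choose (k - i) : ℕ) : ℝ) * (2 * p n) ^ (k.choose 2 - i.choose 2)) atTop (𝓝 0) := by
      intro i hi
      rw [mem_Ico] at hi
      have hiK : i.choose 2 ≤ k.choose 2 := Nat.choose_le_choose 2 hi.2.le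
      have hexp : ((k - i : ℕ) : ℝ) + -(2 : ℝ) / ((k : ℝ) - 1) * ((k.choose 2 - i.choose 2 : ℕ) : ℝ) =
          -((i : ℝ) * ((k : ℝ) - i) / ((k : ℝ) - 1)) := by
        have hk1' : (k : ℝ) - 1 ≠ 0 := by linarith
        rw [Nat.cast_sub hiK, Nat.cast_choose_two, Nat.cast_choose_two, Nat.cast_sub hi.2.le]
        field_simp; ring
      have hi2 : (2 : ℝ) ≤ i := by exact_mod_cast hi.1
      have hik : (i : ℝ) < k := by exact_mod_cast hi.2
      have hneg : 0 < (i : ℝ) * ((k : ℝ) - i) / ((k : ℝ) - 1) := div_pos (mul_pos (by linarith) (by linarith)) (by linarith)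
      have hlim' := ((tendsto_rpow_neg_atTop hneg).comp tendsto_natCast_atTop_atTop).const_mul
        ((k.choose i : ℝ) * 2 ^ (k.choose 2 - i.choose 2))
      rw [mul_zero] at hlim'
      refine squeeze_zero' (Eventually.of_forall fun n =>
        mul_nonneg (Nat.cast_nonneg _) (pow_nonneg (mul_nonneg zero_le_two (hp0 n)) _)) ?_ hlim'
      filter_upwards [eventually_ge_atTop 1] with n hn1
      have hn0 : (0 : ℝ) < n := by exact_mod_cast hn1
      have h1 : ((k.choose i * n.choose (k - i) : ℕ) : ℝ) ≤ (k.choose i : ℝ) * (n : ℝ) ^ ((k - i : ℕ) : ℝ) := by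
        rw [Real.rpow_natCast]; push_cast
        exact mul_le_mul_of_nonneg_left (by exact_mod_cast Nat.choose_le_pow n (k - i)) (Nat.cast_nonneg _)
      calc ((k.choose i * n.choose (k - i) : ℕ) : ℝ) * (2 * p n) ^ (k.choose 2 - i.choose 2)
          ≤ (k.choose i : ℝ) * (n : ℝ) ^ ((k - i : ℕ) : ℝ) *
              (2 ^ (k.choose 2 - i.choose 2) * ((n : ℝ) ^ (-(2 : ℝ) / ((k : ℝ) - 1))) ^ (k.choose 2 - i.choose 2)) := by
            rw [mul_pow, hp n]
            exact mul_le_mul_of_nonneg_right h1 (by positivity)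
        _ = (k.choose i : ℝ) * 2 ^ (k.choose 2 - i.choose 2) * (n : ℝ) ^ (-((i : ℝ) * ((k : ℝ) - i) / ((k : ℝ) - 1))) := by
            rw [← Real.rpow_mul_natCast hn0.le, ← hexp, Real.rpow_add hn0]
            ring
    have hsum := tendsto_finsetSum (Ico 2 k) hterm
    rw [sum_const_zero] at hsum
    exact hsum.congr fun n => (hR n).symm
  -- the error bracket `H = |cc·m - λ|/2 + cc·(2p·m + m(m+R)) - λ²` tends to `0`, `m = up^K/k!`
  have hmlim : Tendsto (fun n : ℕ => up n ^ k.choose 2 / (k.factorial : ℝ)) atTop (𝓝 lam) := by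
    have h := (huplim.pow (k.choose 2)).div_const (k.factorial : ℝ)
    simpa only [one_pow, hlam] using h
  have hHlim : Tendsto (fun n : ℕ => |cc n * (up n ^ k.choose 2 / (k.factorial : ℝ)) - lam| / 2 +
      cc n * (2 * p n * (up n ^ k.choose 2 / (k.factorial : ℝ)) +
        (up n ^ k.choose 2 / (k.factorial : ℝ)) * ((up n ^ k.choose 2 / (k.factorial : ℝ)) + R n)) - lam ^ 2)
      atTop (𝓝 0) := by
    have h1 : Tendsto (fun n : ℕ => |cc n * (up n ^ k.choose 2 / (k.factorial : ℝ)) - lam| / 2) atTop (𝓝 0) := by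
      have h := ((hcclim.mul hmlim).sub (tendsto_const_nhds (x := lam))).abs.div_const 2
      simpa using h
    have h2 : Tendsto (fun n : ℕ => cc n * (2 * p n * (up n ^ k.choose 2 / (k.factorial : ℝ)) +
        (up n ^ k.choose 2 / (k.factorial : ℝ)) * ((up n ^ k.choose 2 / (k.factorial : ℝ)) + R n)) - lam ^ 2)
        atTop (𝓝 0) := by
      have h := (hcclim.mul ((((tendsto_const_nhds (x := (2 : ℝ))).mul hplim).mul hmlim).add
        (hmlim.mul (hmlim.add hRlim)))).sub (tendsto_const_nhds (x := lam ^ 2))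
      have hval : (1 : ℝ) * (2 * 0 * lam + lam * (lam + 0)) - lam ^ 2 = 0 := by ring
      rw [hval] at h
      exact h
    have h := h1.add h2
    rw [add_zero] at h
    simpa only [add_sub_assoc] using h
  have eH := (tendsto_order.1 hHlim).2 ε hε
  have eup : ∀ᶠ n : ℕ in atTop, up n < 2 := (tendsto_order.1 huplim).2 _ (by norm_num)
  have ep : ∀ᶠ n : ℕ in atTop, p n < 1 / 2 := (tendsto_order.1 hplim).2 _ (by norm_num)
  have elow : ∀ᶠ n : ℕ in atTop, (1 / 2 : ℝ) < 1 - (T n) ^ (-(1 / 4 : ℝ)) - 1 / T n :=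
    (tendsto_order.1 (ts_tendsto_lower hTlim)).1 _ (by norm_num)
  have eT : ∀ᶠ n : ℕ in atTop, 8 * (k.choose 2 : ℝ) + 2 ≤ T n := hTlim.eventually_ge_atTop _
  filter_upwards [eH, eup, ep, elow, eT, eventually_ge_atTop k] with n hHn hupn hpn hlown hTn hkn j hj F h2F
  have hK0 : (0 : ℝ) ≤ k.choose 2 := Nat.cast_nonneg _
  have hn1 : 1 ≤ n := by omega
  have hN : 0 < n.choose 2 := Nat.choose_pos (by omega)
  have hNr : (0 : ℝ) < (n.choose 2 : ℕ) := by exact_mod_cast hN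
  have hT0 : 0 < T n := by linarith
  have hup0 : 0 ≤ up n := by
    rw [hup n, Nat.cast_zero, zero_div, add_zero]; exact add_nonneg zero_le_one (Real.rpow_nonneg hT0.le _)
  -- the window: `T/2 ≤ j ≤ T up ≤ C(n,2)`
  have hj' : |(j : ℝ) - (⌊T n⌋₊ : ℝ)| ≤ (⌊T n⌋₊ : ℝ) ^ ((3 : ℝ) / 4) := by
    have h := ts_central_iff.1 hj; rwa [← hp n, ← hT n] at h
  have hjup : (j : ℝ) ≤ T n * up n := by rw [hup n]; exact ts_le_T_mul_upper hT0 hj' (Nat.le_add_right j 0)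
  have hjlo : T n / 2 ≤ j := by
    have h := ts_T_mul_lower_le hT0 hj'
    have h2 : T n / 2 ≤ T n * (1 - T n ^ (-(1 / 4 : ℝ)) - 1 / T n) := by nlinarith
    linarith
  have hjN : j ≤ n.choose 2 := by
    have h : p n * up n ≤ 1 := by nlinarith [hp0 n]
    have : (j : ℝ) ≤ (n.choose 2 : ℕ) := hjup.trans (by rw [hT n, mul_assoc]; exact mul_le_of_le_one_right hNr.le h)
    exact_mod_cast this
  have hKj : 4 * k.choose 2 ≤ j := by
    have : 4 * (k.choose 2 : ℝ) ≤ j := by linarith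
    exact_mod_cast this
  have hKN : 4 * k.choose 2 ≤ n.choose 2 := hKj.trans hjN
  have hj0 : (0 : ℝ) < j := by linarith
  set q : ℝ := (j : ℝ) / (n.choose 2 : ℕ) with hqdef
  have hq0 : 0 ≤ q := div_nonneg (Nat.cast_nonneg _) hNr.le
  have hqp : q ≤ 2 * p n := by
    rw [hqdef, div_le_iff₀ hNr]
    exact hjup.trans (by rw [hT n]; nlinarith [mul_nonneg hNr.le (hp0 n)])
  -- `μ ≤ m = up^K/k!`, `R(q) ≤ R n`, `c_j ≤ cc n`
  set m : ℝ := up n ^ k.choose 2 / (k.factorial : ℝ) with hm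
  have hμ : (n.choose k : ℝ) * q ^ k.choose 2 ≤ m :=
    choose_mul_ratio_pow_le' hk2 hn1 hN (by rw [← hp n, ← hT n]; exact hjup)
  have hRq : ∑ i ∈ Ico 2 k, ((k.choose i * n.choose (k - i) : ℕ) : ℝ) * q ^ (k.choose 2 - i.choose 2) ≤ R n := by
    rw [hR n]
    exact sum_le_sum fun i _ => mul_le_mul_of_nonneg_left (pow_le_pow_left₀ hq0 hqp _) (Nat.cast_nonneg _)
  have hμ0 : 0 ≤ (n.choose k : ℝ) * q ^ k.choose 2 := by positivity
  have hR0 : 0 ≤ ∑ i ∈ Ico 2 k, ((k.choose i * n.choose (k - i) : ℕ) : ℝ) * q ^ (k.choose 2 - i.choose 2) :=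
    sum_nonneg fun i _ => mul_nonneg (Nat.cast_nonneg _) (pow_nonneg hq0 _)
  have hm0 : 0 ≤ m := div_nonneg (pow_nonneg hup0 _) (Nat.cast_nonneg _)
  have hcj : 1 + 4 ^ (k.choose 2 + 1) * (k.choose 2 : ℝ) ^ 2 / j ≤ cc n := by
    rw [hcc n]
    have h1 : (1 : ℝ) / j ≤ 2 / T n := by
      rw [div_le_div_iff₀ hj0 hT0]; linarith
    have h2 : 4 ^ (k.choose 2 + 1) * (k.choose 2 : ℝ) ^ 2 / j = 4 ^ (k.choose 2 + 1) * (k.choose 2 : ℝ) ^ 2 * (1 / j) := by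
      ring
    rw [h2]
    have : (0 : ℝ) ≤ 4 ^ (k.choose 2 + 1) * (k.choose 2 : ℝ) ^ 2 := by positivity
    nlinarith
  have hcc0 : 0 ≤ cc n := le_trans (by positivity) hcj
  -- the deterministic bound and the bracket
  have hdet := lpb_pairBound_det hk2 F hKN hKj hjN h2F
  have hS0 : (0 : ℝ) ≤ #(slice n j) := Nat.cast_nonneg _
  have hFN0 : 0 ≤ (#F : ℝ) / (n.choose 2 : ℕ) := by positivity
  have hFN : (#F : ℝ) / (n.choose 2 : ℕ) ≤ 1 / 2 := by
    rw [div_le_iff₀ hNr]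
    have : (2 * #F : ℝ) ≤ (n.choose 2 : ℕ) := by exact_mod_cast h2F
    linarith
  -- replace `μ, q, R(q), c_j` by `m, 2p, R n, cc n`
  have hbr : (1 + 4 ^ (k.choose 2 + 1) * (k.choose 2 : ℝ) ^ 2 / j) *
      ((#F : ℝ) / (n.choose 2 : ℕ) * ((n.choose k : ℝ) * q ^ k.choose 2) +
        q * ((n.choose k : ℝ) * q ^ k.choose 2) +
        ((n.choose k : ℝ) * q ^ k.choose 2) * (((n.choose k : ℝ) * q ^ k.choose 2) +
          ∑ i ∈ Ico 2 k, ((k.choose i * n.choose (k - i) : ℕ) : ℝ) * q ^ (k.choose 2 - i.choose 2))) ≤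
      cc n * ((#F : ℝ) / (n.choose 2 : ℕ) * m + 2 * p n * m + m * (m + R n)) := by
    have hin : (#F : ℝ) / (n.choose 2 : ℕ) * ((n.choose k : ℝ) * q ^ k.choose 2) +
        q * ((n.choose k : ℝ) * q ^ k.choose 2) +
        ((n.choose k : ℝ) * q ^ k.choose 2) * (((n.choose k : ℝ) * q ^ k.choose 2) +
          ∑ i ∈ Ico 2 k, ((k.choose i * n.choose (k - i) : ℕ) : ℝ) * q ^ (k.choose 2 - i.choose 2)) ≤
        (#F : ℝ) / (n.choose 2 : ℕ) * m + 2 * p n * m + m * (m + R n) := by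
      have h1 := mul_le_mul_of_nonneg_left hμ hFN0
      have h2 : q * ((n.choose k : ℝ) * q ^ k.choose 2) ≤ 2 * p n * m :=
        mul_le_mul hqp hμ hμ0 (by linarith [hp0 n])
      have h3 : ((n.choose k : ℝ) * q ^ k.choose 2) * (((n.choose k : ℝ) * q ^ k.choose 2) +
          ∑ i ∈ Ico 2 k, ((k.choose i * n.choose (k - i) : ℕ) : ℝ) * q ^ (k.choose 2 - i.choose 2)) ≤
          m * (m + R n) := mul_le_mul hμ (add_le_add hμ hRq) (add_nonneg hμ0 hR0) hm0
      linarith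
    have hin0 : 0 ≤ (#F : ℝ) / (n.choose 2 : ℕ) * ((n.choose k : ℝ) * q ^ k.choose 2) +
        q * ((n.choose k : ℝ) * q ^ k.choose 2) +
        ((n.choose k : ℝ) * q ^ k.choose 2) * (((n.choose k : ℝ) * q ^ k.choose 2) +
          ∑ i ∈ Ico 2 k, ((k.choose i * n.choose (k - i) : ℕ) : ℝ) * q ^ (k.choose 2 - i.choose 2)) :=
      add_nonneg (add_nonneg (mul_nonneg hFN0 hμ0) (mul_nonneg hq0 hμ0)) (mul_nonneg hμ0 (add_nonneg hμ0 hR0))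
    exact mul_le_mul hcj hin hin0 hcc0
  -- the bracket is `≤ λ·#F/N + λ² + H n ≤ λ·#F/N + λ² + ε`
  have hfin : cc n * ((#F : ℝ) / (n.choose 2 : ℕ) * m + 2 * p n * m + m * (m + R n)) ≤
      lam ^ 2 + lam * ((#F : ℝ) / (n.choose 2 : ℕ)) + ε := by
    have h1 : cc n * ((#F : ℝ) / (n.choose 2 : ℕ) * m) - lam * ((#F : ℝ) / (n.choose 2 : ℕ)) ≤
        |cc n * m - lam| / 2 := by
      have : cc n * ((#F : ℝ) / (n.choose 2 : ℕ) * m) - lam * ((#F : ℝ) / (n.choose 2 : ℕ)) =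
          (cc n * m - lam) * ((#F : ℝ) / (n.choose 2 : ℕ)) := by ring
      rw [this]
      calc (cc n * m - lam) * ((#F : ℝ) / (n.choose 2 : ℕ)) ≤ |cc n * m - lam| * ((#F : ℝ) / (n.choose 2 : ℕ)) :=
            mul_le_mul_of_nonneg_right (le_abs_self _) hFN0
        _ ≤ |cc n * m - lam| * (1 / 2) := mul_le_mul_of_nonneg_left hFN (abs_nonneg _)
        _ = |cc n * m - lam| / 2 := by ring
    have h2 : cc n * ((#F : ℝ) / (n.choose 2 : ℕ) * m + 2 * p n * m + m * (m + R n)) =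
        cc n * ((#F : ℝ) / (n.choose 2 : ℕ) * m) + cc n * (2 * p n * m + m * (m + R n)) := by ring
    rw [h2]
    have hH := hHn
    simp only [hm] at h1 hH ⊢
    linarith
  refine hdet.trans ?_
  have h1 := mul_le_mul_of_nonneg_right hbr hS0
  have h2 := mul_le_mul_of_nonneg_right hfin hS0
  have h3 : (lam ^ 2 + lam * ((#F : ℝ) / (n.choose 2 : ℕ)) + ε) * #(slice n j) =
      ((1 / (k.factorial : ℝ)) ^ 2 + 1 / (k.factorial : ℝ) * (#F / (n.choose 2 : ℕ)) + ε) * #(slice n j) := by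
    rw [hlam]
  linarith

end
end MineB3
end Summit.PneNP.PneNP.Cruxes.SliceTarget.Ideator3Line
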